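import Literature.AlgebraicGeometry.HodgeTheory.WeilClassesFieldDecomposableOfDivisorForm
import Mathlib.LinearAlgebra.Matrix.ToLin
import Mathlib.LinearAlgebra.Determinant
import Mathlib.LinearAlgebra.Eigenspace.Basic
import Mathlib.FieldTheory.IsAlgClosed.Basic
import Mathlib.Tactic.Module
import HarnessLib

/-!
# Moonen–Zarhin's Criterion (2), the decomposable rows of types 1 and 2: the MORITA MECHANISM — a Rosati-orthogonal
# matrix block of `B ⊗ ℂ` containing `F` forces `G_div(X) ⊆ Sl_F(V_X)` — and the QUATERNION ROW: every subfield
# `F ⊆ ℚ⟨α, β⟩` of an indefinite quaternion algebra acting with Rosati-symmetric generators has decomposable, hence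
# algebraic, Weil classes (Moonen–Zarhin 1998 §1, Criterion (2) and its proof, on the carrier)

Layer `Literature/AlgebraicGeometry/HodgeTheory`; THEOREMS ONLY — no definition, no named fact, no `sorry` (D-0026, net
debt 0).  Sequel of the seat's `WeilClassesFieldDecomposableOfSymmetric` (`φ` Rosati-symmetric),
`WeilClassesFieldDecomposableOfSkew` (`φ` Rosati-skew with a symmetric anticommuting unit) and
`WeilClassesFieldDecomposableOfDivisorForm` (one non-degenerate divisor form on one `V_ρ`): here the GENERATOR `φ` OF `F`
IS ARBITRARY inside a matrix block of the divisor algebra.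

## The print

B. J. J. Moonen, Yu. G. Zarhin, *Weil classes on abelian varieties*, J. reine angew. Math. 496 (1998) 83–92 =
arXiv:alg-geom/9612017 [MoonenZarhin1998WeilClasses] (held text `paper:arxiv-alg-geom_9612017`).  §1, Criterion (2)
(chunk p0003 L46–L58): «Suppose `X` is isogenous to a power `Y^m` of a simple abelian variety `Y` … Then either all
classes in `W_F` are decomposable, or all non-zero classes in `W_F` are exceptional; this last possibility occurs
precisely in the following cases: `Y` is of Type 3 …, `Y` is of Type 4 …» — so for `Y` OF TYPE 1 OR 2 ALL CLASSES OF
`W_F` ARE DECOMPOSABLE, for every subfield `F ⊆ End⁰(X)`.  Its proof (chunk p0003 L82–L90, verbatim): «First assume that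
`X` is either of type 1, 2 or of type 3 with `m = 1`, or that `X` is of type 4 with `d = 1` and `m = 1`.  We claim that, in
these cases, `G_div(X)` acts as the identity on `W_F` if and only if `F ⊆ B`. … Conversely, suppose that `F ⊆ B`, so
that `G_div(X) ⊆ Gl_F(V_X)`.  In the cases we are considering, the group `G_div(X)` is connected and semi-simple, so
`G_div(X) ⊆ Sl_F(V_X)`, hence `G_div(X)` acts trivially on `W_F`.»  The structure behind «connected and semi-simple»
(chunk p0002 L104–L118): «`SP(V_Y, φ_Y) ⊗ ℂ = ∏_τ SP(V^{(τ)}_{Y,ℂ}, φ_Y^{(τ)})` and `Δ ⊗ ℂ = ∏_τ Δ_ℂ^{(τ)}`, where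
`Δ_ℂ^{(τ)}` is a semi-simple `ℂ`-subalgebra of `End(V^{(τ)}_{Y,ℂ})`.  We thus see that `G_div(X) ⊗ ℂ` splits as the
direct product of `e₀` factors `G_div^{(τ)}`.  Writing `k = dim_Δ(V_Y)`, we have the following description of these
factors and their representations `V^{(τ)}_{Y,ℂ}`.  In each case `Stand` denotes the standard representation» — Table 2:
for the types 1 and 2 the block `Δ_ℂ^{(τ)}` is a full matrix algebra `M_n(ℂ)` whose Rosati involution is of ORTHOGONAL
type, `V^{(τ)} = ℂⁿ ⊗ W` and `G_div^{(τ)} = Sp(W)`; Table 1: for type 2 and `m = 1`, `B = D = End⁰(Y)` (the symmetric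
elements generate the quaternion algebra).

## What is proved (the Morita mechanism, classification-free; then the quaternion row)

§1 (namespace `Literature.LinearAlgebra`, any field `K`, `V` finite-dimensional).  A MATRIX BLOCK on `V` is a system
`x, y : ι → End V`, `p ∈ End V` with `yᵢ xⱼ = δᵢⱼ p` and `Σᵢ xᵢ yᵢ = 1` (so `eᵢⱼ = xᵢ yⱼ` are matrix units summing to
`1`, `p = e_{i₀i₀}` the corner idempotent, `W = pV` the multiplicity space, `V ≅ K^ι ⊗ W`).
* `exists_det_restrict_eigenspace_eq_pow` — for `a = Σ cᵢⱼ eᵢⱼ` in the block and `u` commuting with the `xᵢ` and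
  preserving `W`: `det(u | ker(a - τ)) = det(u | W)^l` (`W^l ≅ ker(a - τ)` along the `τ`-eigenvectors of `c`).
* `det_restrict_range_eq_one_of_moritaData` — if a non-degenerate alternating `Φ` makes the block ORTHOGONAL
  (`Φ(xᵢ v, w) = Φ(v, yᵢ w)`, i.e. `eᵢⱼ† = eⱼᵢ`), every `Φ`-isometry preserving `W` has `det(u | W) = 1`.
* **`det_restrict_eigenspace_eq_one_of_moritaData`** — hence every `Φ`-isometry commuting with the block has
  `det(u | ker(a - τ)) = 1` for every `a` in the block and every `τ`.
§2 (the carrier `V = H¹(A(ℂ); ℂ)`, `Φ = Q_h`, `G_div(X)(ℂ) = divisorLefschetzGroup A h`).  For a `Q_h`-orthogonal matrix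
block `x, y, p` inside `B ⊗ ℂ = Algebra.adjoin ℂ (S_λ ⊗ ℂ)` and `φ^*` in the block:
* **`detOnEigenspace_eq_one_of_mem_divisorLefschetzGroup_of_matrixUnits`** — `det(u | V_τ) = 1` for every
  `u ∈ G_div(X)(ℂ)` and every `τ` («`G_div(X) ⊆ Sl_F(V_X)`»);
* **`weilClassesField_le_divisorClassesSpan_of_matrixUnits`** — for `P(φ) = 0` (`P` monic irreducible of degree `e`,
  `e · 2m = 2 dim A`), `h ∈ B¹ ⊗ ℂ` with `Q_h` non-degenerate: `W_F ⊗ ℂ ≤ 𝒟ᵐ ⊗ ℂ` (the seat's g14-#3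
  `weilClassesField_le_divisorClassesSpan_iff_forall_detOnEigenspace_eq_one_of_mem_adjoin`), `≤ ℬᵐ ⊗ ℂ`, `≤ Algᵐ`
  (Lefschetz `(1,1)`, the tree's `lefschetzOneOne_rational_holds`).
§3 THE QUATERNION ROW.  Let `α, β ∈ End(A)` with `α^* α^* = a`, `β^* β^* = b` (`a, b ∈ ℂ` non-zero), `α^* β^* = -β^* α^*`,
and `α^*`, `β^*` both `Q_h`-SYMMETRIC — an action of the quaternion algebra `(a, b)_ℚ` whose Rosati involution is
`x ↦ (αβ)⁻¹ x̄ (αβ)` (the type-2 normal form: `i, j` symmetric, `k = ij` skew).  With `s = α^*/√a`, `t = β^*/√b`,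
`p = ½(1 + s)`: `x = (p, t p)`, `y = (p, p t)` is a `Q_h`-orthogonal `2 × 2` matrix block inside `B ⊗ ℂ` whose span is
`ℂ⟨α^*, β^*⟩` (`exists_matrixUnits_of_quaternionPair`).  Hence for EVERY `φ` with `φ^* ∈ ℂ⟨α^*, β^*⟩` — symmetric
(`φ = α`: g17-#3), skew (`φ = αβ`: g17-#5) OR NEITHER (`φ = α + αβ`, `φ² = a(1 - b)`; the case left open by the
generation-17 successor note (a)) — and `P(φ) = 0` as above:
**`detOnEigenspace_eq_one_of_mem_divisorLefschetzGroup_of_quaternionPair`** (`G_div(X) ⊆ Sl_F(V_X)`),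
**`weilClassesField_le_divisorClassesSpan_of_quaternionPair`** (`W_F` DECOMPOSABLE),
`weilClassesField_le_hodgeClassSpan_of_quaternionPair`, **`weilClassesField_le_algebraicClasses_of_quaternionPair`**
(`W_F` ALGEBRAIC), `mem_algebraicClasses_of_mem_weilClassesField_of_quaternionPair`.

Scope (honest column).  The mechanism needs the matrix block to contain `φ^*` and to sum to `1`: it covers `F` inside
ONE simple block of `B ⊗ ℂ` with orthogonal involution (type 2 with centre `ℚ`, `m = 1`: `F ⊆ D`; and, with the units
`πᵢ^* ιⱼ^*` of a power, the seat's `WeilClassesFieldTensorNumberFieldDecomposable`), not yet `F` meeting a totally real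
centre `E ≠ ℚ` non-trivially (several blocks `τ ∈ Σ_{E₀}` of different corners — the determinant is then a product
over the blocks; left to a sequel), nor the exceptional rows (types 3, 4).  Nothing here identifies `B` from the Albert
type: the block is a HYPOTHESIS (`x, y, p`), discharged in §3 from the quaternion pair.  No algebraic groups, no
connectedness, no classification are used.

## References

* [MoonenZarhin1998WeilClasses] B. J. J. Moonen, Yu. G. Zarhin, Weil classes on abelian varieties, J. reine angew.
  Math. 496 (1998) 83–92; arXiv:alg-geom/9612017: §1 Criterion (2) and its proof (chunk p0003 L46–L90), Lemma (1)–(3),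
  Tables 1–2, «Δ ⊗ ℂ = ∏ Δ^{(τ)}» (chunk p0002 L54–L118).
* [McconnellRobson2001] J. C. McConnell, J. C. Robson, Noncommutative Noetherian Rings, GSM 30 (AMS 2001), 3.5.5–3.5.7
  (matrix rings and progenerators; the Morita equivalence `N ↦ N ⊗ M^*`).
* [McDuffSalamon2017] D. McDuff, D. Salamon, Introduction to Symplectic Topology, 3rd ed. (OUP 2017), Lemma 1.1.15.
* [Milne1999LefschetzClasses] J. S. Milne, Lefschetz classes on abelian varieties, Duke Math. J. 96 (1999), Thm. 3.2,
  Cor. 4.5.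
* [vanGeemenVerra2003QuaternionicPryms] B. van Geemen, A. Verra, Quaternionic Pryms and Hodge classes, Topology 42
  (2003), §4 (abelian varieties of quaternion type; Lemma 4.5).
* [VoisinHodgeI2002] C. Voisin, Hodge Theory and Complex Algebraic Geometry I (CUP 2002), Thm. 11.30.

## Provenance

Lane `lit-hodgefound` (Track 2, Layer A), prover seat `lit-hodgefound-p21` (generation 21), row g21-#1: successor note
(ii) of generation 20 = note (a) of generation 17 («type 2 with a generator that is neither †-symmetric nor †-skew …
needs the Morita reduction `V_σ = ℂ² ⊗ W_σ`»).
-/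

noncomputable section

open Module

/-! ### §1 Linear algebra: matrix blocks, the Morita decomposition of an eigenspace, and the symplectic corner -/

namespace Literature.LinearAlgebra

section Morita

variable {K V : Type*} [Field K] [AddCommGroup V] [Module K V]
variable {ι : Type*} [Fintype ι] [DecidableEq ι]
variable {x y : ι → Module.End K V} {p : Module.End K V}

/-- `xᵢ p = xᵢ` for a system of matrix units `eᵢⱼ = xᵢ yⱼ` (`yᵢ xⱼ = δᵢⱼ p`, `Σ xᵢ yᵢ = 1`). [cite: McconnellRobson2001, 3.5.5–3.5.6 (matrix units and the progenerator of a matrix ring)] -/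
theorem mul_idem_of_moritaData (hxy : ∀ i j, y i * x j = if i = j then p else 0)
    (hsum : ∑ i, x i * y i = 1) (i : ι) : x i * p = x i := by
  symm
  calc x i = (∑ k, x k * y k) * x i := by rw [hsum, one_mul]
    _ = ∑ k, x k * (y k * x i) := by
        rw [Finset.sum_mul]
        exact Finset.sum_congr rfl fun k _ ↦ mul_assoc _ _ _
    _ = ∑ k, (if k = i then x k * p else 0) := by
        refine Finset.sum_congr rfl fun k _ ↦ ?_
        rw [hxy k i]
        split_ifs
        · rfl
        · exact mul_zero _
    _ = x i * p := by rw [Finset.sum_ite_eq' Finset.univ i, if_pos (Finset.mem_univ _)]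

/-- `p yᵢ = yᵢ`. [cite: McconnellRobson2001, 3.5.5–3.5.6] -/
theorem idem_mul_of_moritaData (hxy : ∀ i j, y i * x j = if i = j then p else 0)
    (hsum : ∑ i, x i * y i = 1) (i : ι) : p * y i = y i := by
  symm
  calc y i = y i * ∑ k, x k * y k := by rw [hsum, mul_one]
    _ = ∑ k, (y i * x k) * y k := by
        rw [Finset.mul_sum]
        exact Finset.sum_congr rfl fun k _ ↦ (mul_assoc _ _ _).symm
    _ = ∑ k, (if i = k then p * y k else 0) := by
        refine Finset.sum_congr rfl fun k _ ↦ ?_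
        rw [hxy i k]
        split_ifs
        · rfl
        · exact zero_mul _
    _ = p * y i := by rw [Finset.sum_ite_eq Finset.univ i, if_pos (Finset.mem_univ _)]

/-- `p² = p`: the corner idempotent of the matrix block. [cite: McconnellRobson2001, 3.5.6 (Proposition: `S ≃ e Mₙ(R) e`)] -/
theorem idem_of_moritaData (hxy : ∀ i j, y i * x j = if i = j then p else 0)
    (hsum : ∑ i, x i * y i = 1) : p * p = p := by
  rcases isEmpty_or_nonempty ι with hι | ⟨⟨i⟩⟩
  · have h1 : (1 : Module.End K V) = 0 := by rw [← hsum]; exact Fintype.sum_empty _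
    have h0 : ∀ f : Module.End K V, f = 0 := fun f ↦ by rw [← mul_one f, h1, mul_zero]
    rw [h0 (p * p), h0 p]
  · calc p * p = y i * x i * p := by rw [hxy i i, if_pos rfl]
      _ = y i * x i := by rw [mul_assoc, mul_idem_of_moritaData hxy hsum i]
      _ = p := by rw [hxy i i, if_pos rfl]

/-- `eᵢⱼ e_kl = δⱼₖ eᵢₗ` for the matrix units `eᵢⱼ = xᵢ yⱼ`. [cite: McconnellRobson2001, 3.5.5–3.5.6] -/
theorem unit_mul_unit_of_moritaData (hxy : ∀ i j, y i * x j = if i = j then p else 0)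
    (hsum : ∑ i, x i * y i = 1) (i j k l : ι) :
    (x i * y j) * (x k * y l) = if j = k then x i * y l else 0 := by
  rw [mul_assoc, ← mul_assoc (y j), hxy j k]
  split_ifs
  · rw [← mul_assoc, mul_idem_of_moritaData hxy hsum]
  · rw [zero_mul, mul_zero]

omit [DecidableEq ι] in
/-- `1 = Σ eᵢᵢ` lies in the span of the matrix units. [cite: McconnellRobson2001, 3.5.5–3.5.6] -/
theorem one_mem_span_units_of_moritaData (hsum : ∑ i, x i * y i = 1) :
    (1 : Module.End K V) ∈ Submodule.span K (Set.range fun ij : ι × ι ↦ x ij.1 * y ij.2) := by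
  rw [← hsum]
  exact Submodule.sum_mem _ fun i _ ↦ Submodule.subset_span ⟨(i, i), rfl⟩

/-- The span of the matrix units is closed under multiplication (it is the matrix block `Σ cᵢⱼ eᵢⱼ ≅ M_ι(K)`). [cite: McconnellRobson2001, 3.5.5–3.5.6] -/
theorem mul_mem_span_units_of_moritaData (hxy : ∀ i j, y i * x j = if i = j then p else 0)
    (hsum : ∑ i, x i * y i = 1) {f g : Module.End K V}
    (hf : f ∈ Submodule.span K (Set.range fun ij : ι × ι ↦ x ij.1 * y ij.2))
    (hg : g ∈ Submodule.span K (Set.range fun ij : ι × ι ↦ x ij.1 * y ij.2)) :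
    f * g ∈ Submodule.span K (Set.range fun ij : ι × ι ↦ x ij.1 * y ij.2) := by
  obtain ⟨cf, rfl⟩ := (Submodule.mem_span_range_iff_exists_fun K).1 hf
  obtain ⟨cg, rfl⟩ := (Submodule.mem_span_range_iff_exists_fun K).1 hg
  rw [Finset.sum_mul]
  refine Submodule.sum_mem _ fun ij _ ↦ ?_
  rw [Finset.mul_sum]
  refine Submodule.sum_mem _ fun kl _ ↦ ?_
  rw [smul_mul_assoc, mul_smul_comm, unit_mul_unit_of_moritaData hxy hsum]
  refine Submodule.smul_mem _ _ (Submodule.smul_mem _ _ ?_)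
  split_ifs
  · exact Submodule.subset_span ⟨(ij.1, kl.2), rfl⟩
  · exact Submodule.zero_mem _

/-- A subalgebra generated inside the matrix block stays inside it: `T ⊆ span{eᵢⱼ} ⟹ K[T] ⊆ span{eᵢⱼ}`. [cite: McconnellRobson2001, 3.5.5–3.5.6] -/
theorem adjoin_le_span_units_of_moritaData (hxy : ∀ i j, y i * x j = if i = j then p else 0)
    (hsum : ∑ i, x i * y i = 1) {T : Set (Module.End K V)}
    (hT : T ⊆ Submodule.span K (Set.range fun ij : ι × ι ↦ x ij.1 * y ij.2)) {f : Module.End K V}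
    (hf : f ∈ Algebra.adjoin K T) :
    f ∈ Submodule.span K (Set.range fun ij : ι × ι ↦ x ij.1 * y ij.2) := by
  have h := Algebra.adjoin_le
    (S := (Submodule.span K (Set.range fun ij : ι × ι ↦ x ij.1 * y ij.2)).toSubalgebra
      (one_mem_span_units_of_moritaData hsum) fun _ _ ↦ mul_mem_span_units_of_moritaData hxy hsum) hT
  exact Submodule.mem_toSubalgebra.1 (h hf)

omit [DecidableEq ι] in
/-- Elements of the matrix block are the `Σ cᵢⱼ xᵢ yⱼ`, `c ∈ M_ι(K)`. [cite: McconnellRobson2001, 3.5.5–3.5.6] -/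
theorem exists_eq_sum_smul_of_mem_span_units {f : Module.End K V}
    (hf : f ∈ Submodule.span K (Set.range fun ij : ι × ι ↦ x ij.1 * y ij.2)) :
    ∃ c : Matrix ι ι K, f = ∑ i, ∑ j, c i j • (x i * y j) := by
  obtain ⟨cf, rfl⟩ := (Submodule.mem_span_range_iff_exists_fun K).1 hf
  exact ⟨Matrix.of fun i j ↦ cf (i, j), by rw [Fintype.sum_prod_type]; rfl⟩

/-- **MORITA DECOMPOSITION OF AN EIGENSPACE — `det(u | ker(a - τ)) = det(u | pV)^l`.** Let `eᵢⱼ = xᵢ yⱼ` be a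
system of matrix units on `V` (`yᵢ xⱼ = δᵢⱼ p`, `Σᵢ xᵢ yᵢ = 1`), `a = Σ cᵢⱼ eᵢⱼ` an element of the matrix block
(`c ∈ M_ι(K)`), and `u` an endomorphism commuting with the `xᵢ` and preserving the corner `W = pV`. Then for every `τ`
the map `Θ : (w_α)_α ↦ Σ_α Σ_k ξ_α(k) xₖ w_α` — `(ξ_α)_α` a basis of the `τ`-eigenvectors of `c` — is an isomorphism
`W^l ≅ ker(a - τ)` intertwining `(u|W)^{⊕ l}` with `u|ker(a - τ)` («`V ≅ Stand ⊗ W`», the equivalence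
`N ↦ N ⊗ M^*` between modules over a ring and over its matrix ring, applied to the `c`-eigenspace `ker(c - τ) ⊗ W`);
hence `det(u | ker(a - τ)) = det(u | W)^l`. Proof on coordinates: `yₖ Θ(w) = ξ_α(k) w_α` recovers `w` (injectivity, by
the independence of the `ξ_α` read through a basis of `W`), and for `v ∈ ker(a - τ)` each coordinate column
`(yₖ v)_k ∈ W^ι` is a `τ`-eigenvector of `c ⊗ 1` (surjectivity). [cite: McconnellRobson2001, 3.5.5–3.5.7 (matrix rings, progenerators, the equivalence `N ↦ N ⊗ M^*`)]
[cite: MoonenZarhin1998WeilClasses, §1 («Δ ⊗ ℂ = ∏_τ Δ_ℂ^{(τ)}», «their representations V^{(τ)} … Stand denotes the standard representation»; chunk p0002 L104–L118)] -/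
theorem exists_det_restrict_eigenspace_eq_pow [FiniteDimensional K V]
    (hxy : ∀ i j, y i * x j = if i = j then p else 0) (hsum : ∑ i, x i * y i = 1)
    (c : Matrix ι ι K) {a u : Module.End K V} (ha : a = ∑ i, ∑ j, c i j • (x i * y j))
    (hux : ∀ i, u * x i = x i * u) (τ : K)
    (hV : Set.MapsTo u (a.eigenspace τ) (a.eigenspace τ))
    (hW : Set.MapsTo u (LinearMap.range p) (LinearMap.range p)) :
    ∃ l : ℕ, LinearMap.det (u.restrict hV) = LinearMap.det (u.restrict hW) ^ l := by
  classical
  set W : Submodule K V := LinearMap.range p with hWdef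
  set Vτ : Submodule K V := a.eigenspace τ with hVτdef
  have hpp : p * p = p := idem_of_moritaData hxy hsum
  have hpy : ∀ i, p * y i = y i := idem_mul_of_moritaData hxy hsum
  have hpW : ∀ w ∈ W, p w = w := by
    rintro _ ⟨v, rfl⟩
    rw [← Module.End.mul_apply, hpp]
  have hyW : ∀ i (v : V), y i v ∈ W := fun i v ↦ ⟨y i v, by rw [← Module.End.mul_apply, hpy]⟩
  have hyx : ∀ i j (v : V), y i (x j v) = if i = j then p v else 0 := by
    intro i j v
    rw [← Module.End.mul_apply, hxy]
    split_ifs <;> rfl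
  -- the eigenvectors of the coefficient matrix `c`
  set L : Submodule K (ι → K) := Module.End.eigenspace (Matrix.toLin' c) τ with hLdef
  have hLmem : ∀ ξ : ι → K, ξ ∈ L ↔ ∀ i, ∑ k, c i k * ξ k = τ * ξ i := by
    intro ξ
    rw [Module.End.mem_eigenspace_iff, Matrix.toLin'_apply, funext_iff]
    refine forall_congr' fun i ↦ ?_
    rw [Matrix.mulVec, dotProduct, Pi.smul_apply, smul_eq_mul]
  let bL := Module.finBasis K L
  let bW := Module.finBasis K W
  set l := Module.finrank K L with hldef
  let ξ : Fin l → ι → K := fun α ↦ (bL α : ι → K)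
  have hξ : ∀ α i, ∑ k, c i k * ξ α k = τ * ξ α i := fun α ↦ (hLmem _).1 (bL α).2
  -- the transplant maps `M_α = Σ_k ξ_α(k) x_k`
  let M : Fin l → Module.End K V := fun α ↦ ∑ k, ξ α k • x k
  have hMapply : ∀ α v, M α v = ∑ k, ξ α k • x k v := fun α v ↦ by
    simp only [M, LinearMap.sum_apply, LinearMap.smul_apply]
  have hyM : ∀ k α (v : V), y k (M α v) = ξ α k • p v := by
    intro k α v
    rw [hMapply, map_sum]
    simp_rw [map_smul, hyx, smul_ite, smul_zero]
    rw [Finset.sum_ite_eq, if_pos (Finset.mem_univ _)]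
  have huM : ∀ α v, u (M α v) = M α (u v) := by
    intro α v
    rw [hMapply, hMapply, map_sum]
    refine Finset.sum_congr rfl fun k _ ↦ ?_
    rw [map_smul, ← Module.End.mul_apply, hux, Module.End.mul_apply]
  have haX : ∀ k (w : V), p w = w → a (x k w) = ∑ i, c i k • x i w := by
    intro k w hw
    rw [ha, LinearMap.sum_apply]
    refine Finset.sum_congr rfl fun i _ ↦ ?_
    rw [LinearMap.sum_apply]
    simp_rw [LinearMap.smul_apply, Module.End.mul_apply, hyx, apply_ite (x i), map_zero, smul_ite, smul_zero]
    rw [Finset.sum_ite_eq' Finset.univ k, if_pos (Finset.mem_univ _), hw]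
  have haM : ∀ α (w : V), w ∈ W → a (M α w) = τ • M α w := by
    intro α w hw
    rw [hMapply, map_sum, Finset.smul_sum]
    simp_rw [map_smul, haX _ w (hpW w hw), Finset.smul_sum, smul_smul, mul_comm (ξ α _) (c _ _)]
    rw [Finset.sum_comm]
    exact Finset.sum_congr rfl fun i _ ↦ by rw [← Finset.sum_smul, hξ α i]
  have hMV : ∀ α (w : V), w ∈ W → M α w ∈ Vτ := fun α w hw ↦
    Module.End.mem_eigenspace_iff.2 (haM α w hw)
  -- `Θ : (Fin l → W) → V_τ`, `f ↦ Σ_α M_α (f α)`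
  let Θ₀ : (Fin l → W) →ₗ[K] V := ∑ α, (M α ∘ₗ W.subtype) ∘ₗ LinearMap.proj α
  have hΘ₀ : ∀ f, Θ₀ f = ∑ α, M α (f α) := fun f ↦ by
    simp only [Θ₀, LinearMap.sum_apply, LinearMap.comp_apply, LinearMap.proj_apply, Submodule.subtype_apply]
  let Θ : (Fin l → W) →ₗ[K] Vτ :=
    Θ₀.codRestrict Vτ fun f ↦ by rw [hΘ₀]; exact Submodule.sum_mem _ fun α _ ↦ hMV α _ (f α).2
  have hΘ : ∀ f, (Θ f : V) = ∑ α, M α (f α) := fun f ↦ hΘ₀ f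
  -- a vector `Σ_α ξ_α(k) • w_α = 0` for all `k` forces `w = 0`
  have hsep : ∀ f : Fin l → W, (∀ k, ∑ α, ξ α k • (f α : V) = 0) → f = 0 := by
    intro f hf
    have hco : ∀ j α, bW.repr (f α) j = 0 := by
      intro j
      have hlin : ∑ α, bW.repr (f α) j • bL α = 0 := by
        apply Subtype.ext
        rw [Submodule.coe_sum, Submodule.coe_zero]
        funext k
        simp only [Finset.sum_apply, Submodule.coe_smul, Pi.smul_apply, smul_eq_mul, Pi.zero_apply]
        have hk := hf k
        have hk' : (∑ α, ξ α k • f α : W) = 0 := by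
          apply Subtype.ext
          rw [Submodule.coe_sum, Submodule.coe_zero]
          simpa only [Submodule.coe_smul] using hk
        have := congrArg (fun w : W ↦ bW.repr w j) hk'
        simp only [map_sum, map_smul, Finsupp.coe_finsetSum, Finsupp.coe_smul, Finset.sum_apply,
          Pi.smul_apply, smul_eq_mul, map_zero, Finsupp.coe_zero, Pi.zero_apply] at this
        simpa only [mul_comm] using this
      exact Fintype.linearIndependent_iff.1 bL.linearIndependent _ hlin
    funext α
    exact bW.ext_elem fun j ↦ by rw [hco j α, Pi.zero_apply, map_zero, Finsupp.zero_apply]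
  have hΘinj : Function.Injective Θ := by
    rw [← LinearMap.ker_eq_bot, LinearMap.ker_eq_bot']
    intro f hf
    have hf0 : ∑ α, M α (f α : V) = 0 := by
      rw [← hΘ, hf, Submodule.coe_zero]
    refine hsep f fun k ↦ ?_
    have := congrArg (y k) hf0
    rw [map_sum, map_zero] at this
    simpa only [hyM, hpW _ (f _).2] using this
  have hΘsurj : Function.Surjective Θ := by
    rintro ⟨v, hv⟩
    have hav : a v = τ • v := Module.End.mem_eigenspace_iff.1 hv
    -- `Σ_m c k m • y m v = τ • y k v`
    have hK5 : ∀ k, ∑ m, c k m • y m v = τ • y k v := by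
      intro k
      have h := congrArg (y k) hav
      rw [map_smul, ha, LinearMap.sum_apply, map_sum] at h
      simp_rw [LinearMap.sum_apply, map_sum, LinearMap.smul_apply, map_smul, Module.End.mul_apply, hyx,
        smul_ite, smul_zero] at h
      rw [Finset.sum_comm] at h
      have hpyv : ∀ m, p (y m v) = y m v := fun m ↦ hpW _ (hyW m v)
      simpa only [Finset.sum_ite_eq, Finset.mem_univ, if_true, hpyv] using h
    -- the coordinate vectors `k ↦ (y k v)_j` are eigenvectors of `c`
    let g : ι → Fin (Module.finrank K W) → K := fun k j ↦ bW.repr ⟨y k v, hyW k v⟩ j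
    have hgL : ∀ j, (fun k ↦ g k j) ∈ L := by
      intro j
      refine (hLmem _).2 fun k ↦ ?_
      have h := hK5 k
      have h' : (∑ m, c k m • (⟨y m v, hyW m v⟩ : W)) = τ • ⟨y k v, hyW k v⟩ := by
        apply Subtype.ext
        rw [Submodule.coe_sum, Submodule.coe_smul]
        simpa only [Submodule.coe_smul] using h
      have := congrArg (fun w : W ↦ bW.repr w j) h'
      simpa only [map_sum, map_smul, Finsupp.coe_finsetSum, Finsupp.coe_smul, Finset.sum_apply,
        Pi.smul_apply, smul_eq_mul] using this
    let r : Fin l → Fin (Module.finrank K W) → K := fun α j ↦ bL.repr ⟨_, hgL j⟩ α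
    have hgr : ∀ k j, g k j = ∑ α, r α j * ξ α k := by
      intro k j
      have h := bL.sum_repr ⟨_, hgL j⟩
      have h' := congrArg (fun z : L ↦ (z : ι → K) k) h
      simp only [Submodule.coe_sum, Submodule.coe_smul, Finset.sum_apply, Pi.smul_apply, smul_eq_mul] at h'
      exact h'.symm
    -- `v = Σ_k x_k (y_k v) = Σ_k Σ_j g k j • x_k (bW j)`
    have hv1 : v = ∑ k, x k (y k v) := by
      conv_lhs => rw [← Module.End.one_apply (M := V) (R := K) v, ← hsum]
      rw [LinearMap.sum_apply]
      rfl
    have hv2 : ∀ k, y k v = ∑ j, g k j • (bW j : V) := by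
      intro k
      have h := bW.sum_repr ⟨y k v, hyW k v⟩
      have h' := congrArg Subtype.val h
      rw [Submodule.coe_sum] at h'
      simpa only [Submodule.coe_smul] using h'.symm
    refine ⟨fun α ↦ ∑ j, r α j • bW j, Subtype.ext ?_⟩
    rw [hΘ]
    refine (?_ : _ = ∑ k, x k (y k v)).trans hv1.symm
    simp_rw [hv2, map_sum, map_smul, hgr, Finset.sum_smul, Submodule.coe_sum, Submodule.coe_smul, hMapply,
      map_sum, map_smul, Finset.smul_sum, smul_smul]
    -- both sides are triple sums of `(r α j * ξ α k) • x k (bW j)`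
    rw [Finset.sum_comm]
    refine Finset.sum_congr rfl fun k _ ↦ ?_
    rw [Finset.sum_comm]
    exact Finset.sum_congr rfl fun j _ ↦ Finset.sum_congr rfl fun α _ ↦ by rw [mul_comm]
  -- conjugate: `u|V_τ = Θ ∘ (u|W)^{⊕ l} ∘ Θ⁻¹`
  let Θe : (Fin l → W) ≃ₗ[K] Vτ := LinearEquiv.ofBijective Θ ⟨hΘinj, hΘsurj⟩
  let D : (Fin l → W) →ₗ[K] (Fin l → W) := LinearMap.pi fun α ↦ (u.restrict hW).comp (LinearMap.proj α)
  have hinter : (u.restrict hV) ∘ₗ Θ = Θ ∘ₗ D := by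
    refine LinearMap.ext fun f ↦ Subtype.ext ?_
    rw [LinearMap.comp_apply, LinearMap.comp_apply, LinearMap.coe_restrict_apply, hΘ, hΘ, map_sum]
    refine Finset.sum_congr rfl fun α _ ↦ ?_
    rw [huM]
    rfl
  have hconj : u.restrict hV = (Θe : (Fin l → W) →ₗ[K] Vτ) ∘ₗ D ∘ₗ (Θe.symm : Vτ →ₗ[K] (Fin l → W)) := by
    refine LinearMap.ext fun z ↦ ?_
    have h := congrArg (fun F ↦ F (Θe.symm z)) hinter
    simp only [LinearMap.comp_apply] at h
    rw [LinearMap.comp_apply, LinearMap.comp_apply]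
    change _ = Θ (D (Θe.symm z))
    rw [← h]
    have hz : Θ (Θe.symm z) = z := Θe.apply_symm_apply z
    rw [hz]
  refine ⟨l, ?_⟩
  rw [hconj, LinearMap.det_conj, LinearMap.det_pi, Finset.prod_const, Finset.card_univ, Fintype.card_fin]

/-- An endomorphism commuting with all `xᵢ`, `yᵢ` commutes with the corner idempotent `p`. [cite: McconnellRobson2001, 3.5.6] -/
theorem comm_idem_of_moritaData (hxy : ∀ i j, y i * x j = if i = j then p else 0)
    (hsum : ∑ i, x i * y i = 1) {u : Module.End K V} (hux : ∀ i, u * x i = x i * u)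
    (huy : ∀ i, u * y i = y i * u) : u * p = p * u := by
  rcases isEmpty_or_nonempty ι with hι | ⟨⟨i⟩⟩
  · have h1 : (1 : Module.End K V) = 0 := by rw [← hsum]; exact Fintype.sum_empty _
    have h0 : ∀ f : Module.End K V, f = 0 := fun f ↦ by rw [← mul_one f, h1, mul_zero]
    rw [h0 (u * p), h0 (p * u)]
  · have hp : p = y i * x i := by rw [hxy i i, if_pos rfl]
    rw [hp, ← mul_assoc, huy, mul_assoc, hux, mul_assoc]

/-- **THE SYMPLECTIC FACTOR — `det(u | pV) = 1`.** If `Φ` is a non-degenerate alternating form on `V` for which the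
matrix units are `Φ`-ORTHOGONAL (`xᵢ† = yᵢ`, i.e. `Φ(xᵢ v, w) = Φ(v, yᵢ w)`, so `eᵢⱼ† = eⱼᵢ` and `p† = p`), then the
corner `W = pV` is a non-degenerate symplectic subspace and every `Φ`-isometry `u` preserving `W` has `det(u | W) = 1`
(the factor «`G_div^{(τ)} ≅ Sp(W)`» of the print's Table 2 for the types 1 and 2; an isometry of a non-degenerate
alternating form has determinant `1`, the tree's `det_restrict_eq_one_of_isAlt_of_forall_apply_apply_eq`).
[cite: MoonenZarhin1998WeilClasses, §1 Lemma (1)–(2) and Table 2 («G_div(X) ⊗ ℂ splits as the direct product of e₀ factors G_div^{(τ)}»; chunk p0002 L104–L118, p0003 L1–L12)]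
[cite: McDuffSalamon2017, Lemma 1.1.15] -/
theorem det_restrict_range_eq_one_of_moritaData [FiniteDimensional K V]
    (hxy : ∀ i j, y i * x j = if i = j then p else 0) (hsum : ∑ i, x i * y i = 1)
    (Φ : LinearMap.BilinForm K V) (halt : ∀ v, Φ v v = 0) (hsep : ∀ v, (∀ w, Φ v w = 0) → v = 0)
    (hadj : ∀ i v w, Φ (x i v) w = Φ v (y i w)) {u : Module.End K V}
    (hiso : ∀ v w, Φ (u v) (u w) = Φ v w) (hW : Set.MapsTo u (LinearMap.range p) (LinearMap.range p)) :
    LinearMap.det (u.restrict hW) = 1 := by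
  have hskew : ∀ v w, Φ v w = -Φ w v := fun v w ↦ by
    have h := halt (v + w)
    simp only [map_add, LinearMap.add_apply, halt, zero_add, add_zero] at h
    exact eq_neg_of_add_eq_zero_right h
  have hadj' : ∀ i v w, Φ (y i v) w = Φ v (x i w) := fun i v w ↦ by
    rw [hskew, ← hadj, ← hskew]
  have hpadj : ∀ v w, Φ (p v) w = Φ v (p w) := by
    intro v w
    rcases isEmpty_or_nonempty ι with hι | ⟨⟨i⟩⟩
    · have h1 : (1 : Module.End K V) = 0 := by rw [← hsum]; exact Fintype.sum_empty _
      have hv0 : ∀ z : V, z = 0 := fun z ↦ by rw [← Module.End.one_apply (R := K) z, h1, LinearMap.zero_apply]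
      rw [hv0 (p v), hv0 v, map_zero, LinearMap.zero_apply, LinearMap.zero_apply]
    · have hp : p = y i * x i := by rw [hxy i i, if_pos rfl]
      rw [hp, Module.End.mul_apply, Module.End.mul_apply, hadj', hadj]
  have hpp : p * p = p := idem_of_moritaData hxy hsum
  have hpW : ∀ w ∈ LinearMap.range p, p w = w := by
    rintro _ ⟨v, rfl⟩
    rw [← Module.End.mul_apply, hpp]
  refine det_restrict_eq_one_of_isAlt_of_forall_apply_apply_eq Φ hW (fun v _ ↦ halt v)
    (fun v hv hv0 ↦ hsep v fun w ↦ ?_) fun v _ w _ ↦ hiso v w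
  rw [← hpW v hv, hpadj]
  exact hv0 _ ⟨w, rfl⟩

/-- **`det(u | ker(a - τ)) = 1` — the centraliser of a `Φ`-orthogonal matrix block acts with determinant one on every
eigenspace of every element of the block.** For a non-degenerate alternating `Φ`, matrix units with `xᵢ† = yᵢ`, a
`Φ`-isometry `u` commuting with all `xᵢ`, `yᵢ`, and `a = Σ cᵢⱼ xᵢ yⱼ`: `det(u | ker(a - τ)) = det(u | pV)^l = 1` for every
`τ ∈ K` (the two previous theorems). This is the print's «`G_div(X)` is connected and semi-simple, so
`G_div(X) ⊆ Sl_F(V_X)`» for the types 1 and 2, rendered without algebraic groups: the centraliser of `M_n(ℂ)` with its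
orthogonal involution inside `Sp(V, Φ)` is `Sp(W)` acting on `V = ℂⁿ ⊗ W`, and `ker(a - τ) = ker(c - τ) ⊗ W`.
[cite: MoonenZarhin1998WeilClasses, §1 proof of Criterion (2), types 1 and 2 (chunk p0003 L82–L90), with Table 2 and «Δ ⊗ ℂ = ∏_τ Δ_ℂ^{(τ)}» (chunk p0002 L104–L118)]
[cite: McconnellRobson2001, 3.5.5–3.5.7] [cite: McDuffSalamon2017, Lemma 1.1.15] -/
theorem det_restrict_eigenspace_eq_one_of_moritaData [FiniteDimensional K V]
    (hxy : ∀ i j, y i * x j = if i = j then p else 0) (hsum : ∑ i, x i * y i = 1)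
    (Φ : LinearMap.BilinForm K V) (halt : ∀ v, Φ v v = 0) (hsep : ∀ v, (∀ w, Φ v w = 0) → v = 0)
    (hadj : ∀ i v w, Φ (x i v) w = Φ v (y i w)) (c : Matrix ι ι K) {a u : Module.End K V}
    (ha : a = ∑ i, ∑ j, c i j • (x i * y j)) (hux : ∀ i, u * x i = x i * u) (huy : ∀ i, u * y i = y i * u)
    (hiso : ∀ v w, Φ (u v) (u w) = Φ v w) (τ : K) (hV : Set.MapsTo u (a.eigenspace τ) (a.eigenspace τ)) :
    LinearMap.det (u.restrict hV) = 1 := by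
  have hup : u * p = p * u := comm_idem_of_moritaData hxy hsum hux huy
  have hW : Set.MapsTo u (LinearMap.range p) (LinearMap.range p) := by
    rintro _ ⟨v, rfl⟩
    exact ⟨u v, by rw [← Module.End.mul_apply, ← hup, Module.End.mul_apply]⟩
  obtain ⟨l, hl⟩ := exists_det_restrict_eigenspace_eq_pow hxy hsum c ha hux τ hV hW
  rw [hl, det_restrict_range_eq_one_of_moritaData hxy hsum Φ halt hsep hadj hiso hW, one_pow]

end Morita

/-! ### §1′ The `2 × 2` block of an anticommuting pair of involutions `s² = t² = 1`, `st = -ts` (private calculus) -/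

section QuaternionPair

variable {R : Type*} [Ring R] [Algebra ℂ R] {s t : R}

/-- `p² = p` for `p = ½(1 + s)`, `s² = 1`. [folklore] -/
private theorem half_one_add_mul_self (hs : s * s = 1) :
    ((2:ℂ)⁻¹ • (1 + s)) * ((2:ℂ)⁻¹ • (1 + s)) = (2:ℂ)⁻¹ • (1 + s) := by
  rw [smul_mul_assoc, mul_smul_comm, smul_smul, mul_add, add_mul, add_mul, one_mul, mul_one, one_mul, hs]
  module

/-- `p t p = 0`. [folklore] -/
private theorem half_one_add_mul_mul_half_one_add (hs : s * s = 1) (hst : s * t = -(t * s)) :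
    ((2:ℂ)⁻¹ • (1 + s)) * t * ((2:ℂ)⁻¹ • (1 + s)) = 0 := by
  have hsts : s * t * s = -t := by rw [hst, neg_mul, mul_assoc, hs, mul_one]
  rw [smul_mul_assoc, smul_mul_assoc, mul_smul_comm, smul_smul, add_mul, add_mul, one_mul, mul_add,
    mul_add, mul_one, mul_one, hsts, hst]
  module

/-- `t p t = q = ½(1 - s)`. [folklore] -/
private theorem mul_half_one_add_mul (ht : t * t = 1) (hst : s * t = -(t * s)) :
    t * ((2:ℂ)⁻¹ • (1 + s)) * t = (2:ℂ)⁻¹ • (1 - s) := by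
  have htst : t * s * t = -s := by rw [mul_assoc, hst, mul_neg, ← mul_assoc, ht, one_mul]
  rw [mul_smul_comm, smul_mul_assoc, mul_add, add_mul, mul_one, ht, htst]
  module

/-- `p + q = 1`. [folklore] -/
private theorem half_one_add_add_half_one_sub : (2:ℂ)⁻¹ • (1 + s) + (2:ℂ)⁻¹ • (1 - s) = 1 := by module

/-- `p - q = s`. [folklore] -/
private theorem half_one_add_sub_half_one_sub : (2:ℂ)⁻¹ • (1 + s) - (2:ℂ)⁻¹ • (1 - s) = s := by module

/-- `p t = t q`. [folklore] -/
private theorem half_one_add_mul_eq (hst : s * t = -(t * s)) :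
    ((2:ℂ)⁻¹ • (1 + s)) * t = t * ((2:ℂ)⁻¹ • (1 - s)) := by
  rw [smul_mul_assoc, mul_smul_comm, add_mul, one_mul, hst, mul_sub, mul_one]
  module

/-- `t = t p + p t`. [folklore] -/
private theorem eq_mul_half_one_add_add (hst : s * t = -(t * s)) :
    t * ((2:ℂ)⁻¹ • (1 + s)) + ((2:ℂ)⁻¹ • (1 + s)) * t = t := by
  rw [half_one_add_mul_eq hst, ← mul_add, half_one_add_add_half_one_sub, mul_one]

end QuaternionPair

end Literature.LinearAlgebra

/-! ### §2 The carrier `H¹(A(ℂ); ℂ)`: a `Q_h`-orthogonal matrix block of `B ⊗ ℂ` containing `φ^*` forces `G_div(X) ⊆ Sl_F(V_X)` -/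

namespace Literature.AlgebraicGeometry.HodgeTheory

open CategoryTheory
open Literature.AlgebraicGeometry.Motives
open Literature.AlgebraicGeometry.VanGeemen1994 (hodgeClassSpan pullbackOne detOnEigenspace)
open Literature.AlgebraicGeometry.Milne1999 (exists_injective_linearMap_topDegree)
open Literature.AlgebraicTopology.SingularHomology
open Literature.Barriers.HodgeConjecture (divisorClassesSpan)
open Literature.LinearAlgebra

section HodgeTheory

variable {A : AbelianVariety ℂ} {h : complexBetti A.X 2} {φ : A ⟶ A} {P : Polynomial ℤ} {e m : ℕ}
  {ι : Type*} [Fintype ι] [DecidableEq ι] {x y : ι → Module.End ℂ (complexBetti A.X 1)}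
  {p : Module.End ℂ (complexBetti A.X 1)} {u : complexBetti A.X 1 ≃ₗ[ℂ] complexBetti A.X 1}

/-- **THE MORITA MECHANISM ON THE CARRIER — `det(u | V_τ) = 1`.** Let `x, y : ι → End(H¹(A(ℂ); ℂ))`, `p` be a matrix
block (`yᵢ xⱼ = δᵢⱼ p`, `Σ xᵢ yᵢ = 1`) which is `Q_h`-ORTHOGONAL (`Q_h(xᵢ v, w) = Q_h(v, yᵢ w)`), `Q_h` non-degenerate,
and `φ^*` in the block (`φ^* ∈ span{xᵢ yⱼ}`). Then every `Q_h`-isometry `u` commuting with the `xᵢ`, `yᵢ` (and with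
`φ^*`) has `det(u | V_τ) = 1` on every eigenspace `V_τ = ker(φ^* - τ)`: §1 with `Φ = ℓ ∘ Q_h` for an injective functional
`ℓ` on the top line `H^{2 dim A}` (`Milne1999.exists_injective_linearMap_topDegree`; `Q_h` is alternating by graded
commutativity). [cite: MoonenZarhin1998WeilClasses, §1 proof of Criterion (2), types 1 and 2 (chunk p0003 L82–L90); Table 2 and «G_div(X) ⊗ ℂ splits as the direct product of e₀ factors G_div^{(τ)}» (chunk p0002 L104–L118)]
[cite: McconnellRobson2001, 3.5.5–3.5.7] [cite: McDuffSalamon2017, Lemma 1.1.15] -/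
theorem detOnEigenspace_eq_one_of_matrixUnits
    (hxy : ∀ i j, y i * x j = if i = j then p else 0) (hsum : ∑ i, x i * y i = 1)
    (hadj : ∀ i (v w : complexBetti A.X 1), polarizationPairingOne A.X h (A.dim - 1) (x i v) w =
      polarizationPairingOne A.X h (A.dim - 1) v (y i w))
    (hnd : ∀ v : complexBetti A.X 1, (∀ w, polarizationPairingOne A.X h (A.dim - 1) v w = 0) → v = 0)
    (hF : pullbackOne A φ ∈ Submodule.span ℂ (Set.range fun ij : ι × ι ↦ x ij.1 * y ij.2))
    (hux : ∀ i v, u (x i v) = x i (u v)) (huy : ∀ i v, u (y i v) = y i (u v))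
    (huQ : ∀ v w : complexBetti A.X 1, polarizationPairingOne A.X h (A.dim - 1) (u v) (u w) =
      polarizationPairingOne A.X h (A.dim - 1) v w)
    (hc : ∀ v, u (pullbackOne A φ v) = pullbackOne A φ (u v)) (τ : ℂ) :
    detOnEigenspace u (pullbackOne A φ) hc τ = 1 := by
  classical
  haveI : Module.Finite ℂ (complexBetti A.X 1) := abelianVarietyCohomologyExteriorH1_holds.finite_one A
  obtain ⟨ℓ, hℓ⟩ := exists_injective_linearMap_topDegree A
  obtain ⟨c, hcφ⟩ := exists_eq_sum_smul_of_mem_span_units hF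
  set Φ : LinearMap.BilinForm ℂ (complexBetti A.X 1) :=
    (polarizationPairingOne A.X h (A.dim - 1)).compr₂ ℓ with hΦdef
  have hΦapply : ∀ v w, Φ v w = ℓ (polarizationPairingOne A.X h (A.dim - 1) v w) := fun _ _ ↦ rfl
  have hux' : ∀ i, (u : complexBetti A.X 1 →ₗ[ℂ] complexBetti A.X 1) * x i = x i * u := fun i ↦
    LinearMap.ext fun v ↦ by rw [Module.End.mul_apply, Module.End.mul_apply, LinearEquiv.coe_coe, hux]
  have huy' : ∀ i, (u : complexBetti A.X 1 →ₗ[ℂ] complexBetti A.X 1) * y i = y i * u := fun i ↦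
    LinearMap.ext fun v ↦ by rw [Module.End.mul_apply, Module.End.mul_apply, LinearEquiv.coe_coe, huy]
  unfold detOnEigenspace
  refine det_restrict_eigenspace_eq_one_of_moritaData hxy hsum Φ (fun v ↦ ?_)
    (fun v hv ↦ hnd v fun w ↦ hℓ ?_) (fun i v w ↦ ?_) c hcφ hux' huy' (fun v w ↦ ?_) τ _
  · rw [hΦapply, polarizationPairingOne_self, map_zero]
  · rw [← hΦapply, hv w, map_zero]
  · rw [hΦapply, hΦapply, hadj]
  · rw [hΦapply, hΦapply, LinearEquiv.coe_coe, huQ]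

omit [DecidableEq ι] in
/-- A block inside `B ⊗ ℂ` containing `φ^*` puts `φ^*` in `B ⊗ ℂ` («`F ⊆ B`»). [cite: MoonenZarhin1998WeilClasses, §1 proof of Criterion (2) (chunk p0003 L82–L90)] -/
theorem pullbackOne_mem_adjoin_of_mem_span_units
    (hx : ∀ i, x i ∈ Algebra.adjoin ℂ (symmetricPullbackSpan A h : Set (Module.End ℂ (complexBetti A.X 1))))
    (hy : ∀ i, y i ∈ Algebra.adjoin ℂ (symmetricPullbackSpan A h : Set (Module.End ℂ (complexBetti A.X 1))))
    (hF : pullbackOne A φ ∈ Submodule.span ℂ (Set.range fun ij : ι × ι ↦ x ij.1 * y ij.2)) :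
    pullbackOne A φ ∈ Algebra.adjoin ℂ (symmetricPullbackSpan A h : Set (Module.End ℂ (complexBetti A.X 1))) := by
  obtain ⟨c, hcφ⟩ := exists_eq_sum_smul_of_mem_span_units hF
  rw [hcφ]
  exact Subalgebra.sum_mem _ fun i _ ↦ Subalgebra.sum_mem _ fun j _ ↦
    Subalgebra.smul_mem _ (Subalgebra.mul_mem _ (hx i) (hy j)) _

/-- **«`G_div(X) ⊆ Sl_F(V_X)`» FOR `F` INSIDE A ROSATI-ORTHOGONAL MATRIX BLOCK OF `B ⊗ ℂ`** — every complex abelian variety,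
every `h` with `Q_h` non-degenerate: if `x, y, p` is a `Q_h`-orthogonal matrix block with all `xᵢ, yᵢ ∈ B ⊗ ℂ` and
`φ^* ∈ span{xᵢ yⱼ}`, then every `u ∈ G_div(X)(ℂ)` has `det(u | V_τ) = 1` for every `τ` (it commutes with `B ⊗ ℂ`,
`divisorLefschetzGroup_comm_of_mem_adjoin`, and preserves `Q_h`). This is the print's «in the cases we are considering
[types 1, 2], the group `G_div(X)` is connected and semi-simple, so `G_div(X) ⊆ Sl_F(V_X)`», with the algebraic-group
input replaced by the Morita structure of the block. [cite: MoonenZarhin1998WeilClasses, §1 proof of Criterion (2) (chunk p0003 L82–L90); Lemma (1)–(2), Table 2 (chunk p0002 L104–L118, p0003 L1–L12)]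
[cite: McconnellRobson2001, 3.5.5–3.5.7] [cite: McDuffSalamon2017, Lemma 1.1.15] -/
theorem detOnEigenspace_eq_one_of_mem_divisorLefschetzGroup_of_matrixUnits
    (hxy : ∀ i j, y i * x j = if i = j then p else 0) (hsum : ∑ i, x i * y i = 1)
    (hadj : ∀ i (v w : complexBetti A.X 1), polarizationPairingOne A.X h (A.dim - 1) (x i v) w =
      polarizationPairingOne A.X h (A.dim - 1) v (y i w))
    (hnd : ∀ v : complexBetti A.X 1, (∀ w, polarizationPairingOne A.X h (A.dim - 1) v w = 0) → v = 0)
    (hx : ∀ i, x i ∈ Algebra.adjoin ℂ (symmetricPullbackSpan A h : Set (Module.End ℂ (complexBetti A.X 1))))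
    (hy : ∀ i, y i ∈ Algebra.adjoin ℂ (symmetricPullbackSpan A h : Set (Module.End ℂ (complexBetti A.X 1))))
    (hF : pullbackOne A φ ∈ Submodule.span ℂ (Set.range fun ij : ι × ι ↦ x ij.1 * y ij.2))
    (hu : u ∈ divisorLefschetzGroup A h) (hc : ∀ v, u (pullbackOne A φ v) = pullbackOne A φ (u v)) (τ : ℂ) :
    detOnEigenspace u (pullbackOne A φ) hc τ = 1 :=
  detOnEigenspace_eq_one_of_matrixUnits hxy hsum hadj hnd hF
    (fun i v ↦ divisorLefschetzGroup_comm_of_mem_adjoin hu (hx i) v)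
    (fun i v ↦ divisorLefschetzGroup_comm_of_mem_adjoin hu (hy i) v) hu.2 hc τ

/-- **`W_F` IS DECOMPOSABLE FOR `F` INSIDE A ROSATI-ORTHOGONAL MATRIX BLOCK OF `B ⊗ ℂ`** — Moonen–Zarhin's Criterion (2),
the decomposable alternative of the types 1 and 2, by the Morita mechanism: for `P(φ) = 0` (`P ∈ ℤ[T]` monic
irreducible of degree `e`, `e · 2m = 2 dim A`), `h ∈ B¹(A) ⊗ ℂ` with `Q_h` non-degenerate, and a `Q_h`-orthogonal matrix
block `x, y, p` of `B ⊗ ℂ` with `φ^* ∈ span{xᵢ yⱼ}`: `W_F ⊗ ℂ ≤ 𝒟ᵐ ⊗ ℂ` (§2's determinant one at every root, then the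
seat's g14-#3 `weilClassesField_le_divisorClassesSpan_iff_forall_detOnEigenspace_eq_one_of_mem_adjoin`).
[cite: MoonenZarhin1998WeilClasses, §1 Criterion (2) and its proof (chunk p0003 L46–L90)] [cite: Milne1999LefschetzClasses, Thm. 3.2, Cor. 4.5]
[cite: McconnellRobson2001, 3.5.5–3.5.7] -/
theorem weilClassesField_le_divisorClassesSpan_of_matrixUnits
    (hPm : P.Monic) (hPe : P.natDegree = e) (hPirr : Irreducible (P.map (Int.castRingHom ℚ)))
    (hφ : Polynomial.eval₂ (Int.castRingHom (CategoryTheory.End A)) (φ : CategoryTheory.End A) P = 0)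
    (her : e * (2 * m) = 2 * A.dim) (hh : h ∈ hodgeClassSpan A.dim A.X 1)
    (hnd : ∀ v : complexBetti A.X 1, (∀ w, polarizationPairingOne A.X h (A.dim - 1) v w = 0) → v = 0)
    (hxy : ∀ i j, y i * x j = if i = j then p else 0) (hsum : ∑ i, x i * y i = 1)
    (hadj : ∀ i (v w : complexBetti A.X 1), polarizationPairingOne A.X h (A.dim - 1) (x i v) w =
      polarizationPairingOne A.X h (A.dim - 1) v (y i w))
    (hx : ∀ i, x i ∈ Algebra.adjoin ℂ (symmetricPullbackSpan A h : Set (Module.End ℂ (complexBetti A.X 1))))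
    (hy : ∀ i, y i ∈ Algebra.adjoin ℂ (symmetricPullbackSpan A h : Set (Module.End ℂ (complexBetti A.X 1))))
    (hF : pullbackOne A φ ∈ Submodule.span ℂ (Set.range fun ij : ι × ι ↦ x ij.1 * y ij.2)) :
    weilClassesField A φ P (2 * m) ≤ divisorClassesSpan A.X A.dim m :=
  (weilClassesField_le_divisorClassesSpan_iff_forall_detOnEigenspace_eq_one_of_mem_adjoin hPm hPe hPirr hφ her hh hnd
      (pullbackOne_mem_adjoin_of_mem_span_units hx hy hF)).2
    fun _ hu τ _ ↦ detOnEigenspace_eq_one_of_mem_divisorLefschetzGroup_of_matrixUnits hxy hsum hadj hnd hx hy hF hu _ τ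

/-- **… and consists of HODGE classes**: `W_F ⊗ ℂ ≤ 𝒟ᵐ ⊗ ℂ ≤ ℬᵐ ⊗ ℂ`
(`divisorClassesSpan_le_hodgeClassSpan_of_isSmoothProjective`). [cite: MoonenZarhin1998WeilClasses, §1 Criterion (2) (chunk p0003 L46–L58)]
[cite: vanGeemen1994HodgeAV, §2.4] -/
theorem weilClassesField_le_hodgeClassSpan_of_matrixUnits
    (hPm : P.Monic) (hPe : P.natDegree = e) (hPirr : Irreducible (P.map (Int.castRingHom ℚ)))
    (hφ : Polynomial.eval₂ (Int.castRingHom (CategoryTheory.End A)) (φ : CategoryTheory.End A) P = 0)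
    (her : e * (2 * m) = 2 * A.dim) (hh : h ∈ hodgeClassSpan A.dim A.X 1)
    (hnd : ∀ v : complexBetti A.X 1, (∀ w, polarizationPairingOne A.X h (A.dim - 1) v w = 0) → v = 0)
    (hxy : ∀ i j, y i * x j = if i = j then p else 0) (hsum : ∑ i, x i * y i = 1)
    (hadj : ∀ i (v w : complexBetti A.X 1), polarizationPairingOne A.X h (A.dim - 1) (x i v) w =
      polarizationPairingOne A.X h (A.dim - 1) v (y i w))
    (hx : ∀ i, x i ∈ Algebra.adjoin ℂ (symmetricPullbackSpan A h : Set (Module.End ℂ (complexBetti A.X 1))))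
    (hy : ∀ i, y i ∈ Algebra.adjoin ℂ (symmetricPullbackSpan A h : Set (Module.End ℂ (complexBetti A.X 1))))
    (hF : pullbackOne A φ ∈ Submodule.span ℂ (Set.range fun ij : ι × ι ↦ x ij.1 * y ij.2)) :
    weilClassesField A φ P (2 * m) ≤ hodgeClassSpan A.dim A.X m :=
  (weilClassesField_le_divisorClassesSpan_of_matrixUnits hPm hPe hPirr hφ her hh hnd hxy hsum hadj hx hy hF).trans
    (divisorClassesSpan_le_hodgeClassSpan_of_isSmoothProjective (AbelianVariety.isSmoothProjective_holds (A := A)) m)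

/-- **… and is ALGEBRAIC**: `W_F ⊗ ℂ ≤ algebraicClasses A.X m` — «as a consequence of the Lefschetz theorem on `(1,1)`
classes, the decomposable classes are algebraic» (the tree's `lefschetzOneOne_rational_holds` through
`AbelianVariety.divisorClassesSpan_le_algebraicClasses`).
[cite: MoonenZarhin1998WeilClasses, Introduction (chunk p0001 L10–L18) and §1 Criterion (2) (chunk p0003 L46–L90)]
[cite: VoisinHodgeI2002, Thm. 11.30] -/
theorem weilClassesField_le_algebraicClasses_of_matrixUnits
    (hPm : P.Monic) (hPe : P.natDegree = e) (hPirr : Irreducible (P.map (Int.castRingHom ℚ)))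
    (hφ : Polynomial.eval₂ (Int.castRingHom (CategoryTheory.End A)) (φ : CategoryTheory.End A) P = 0)
    (her : e * (2 * m) = 2 * A.dim) (hh : h ∈ hodgeClassSpan A.dim A.X 1)
    (hnd : ∀ v : complexBetti A.X 1, (∀ w, polarizationPairingOne A.X h (A.dim - 1) v w = 0) → v = 0)
    (hxy : ∀ i j, y i * x j = if i = j then p else 0) (hsum : ∑ i, x i * y i = 1)
    (hadj : ∀ i (v w : complexBetti A.X 1), polarizationPairingOne A.X h (A.dim - 1) (x i v) w =
      polarizationPairingOne A.X h (A.dim - 1) v (y i w))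
    (hx : ∀ i, x i ∈ Algebra.adjoin ℂ (symmetricPullbackSpan A h : Set (Module.End ℂ (complexBetti A.X 1))))
    (hy : ∀ i, y i ∈ Algebra.adjoin ℂ (symmetricPullbackSpan A h : Set (Module.End ℂ (complexBetti A.X 1))))
    (hF : pullbackOne A φ ∈ Submodule.span ℂ (Set.range fun ij : ι × ι ↦ x ij.1 * y ij.2)) :
    weilClassesField A φ P (2 * m) ≤ algebraicClasses A.X m :=
  (weilClassesField_le_divisorClassesSpan_of_matrixUnits hPm hPe hPirr hφ her hh hnd hxy hsum hadj hx hy hF).trans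
    (AbelianVariety.divisorClassesSpan_le_algebraicClasses A
      (fun b hb hb' ↦ lefschetzOneOne_rational_holds (AbelianVariety.isSmoothProjective_holds (A := A)) b hb hb') m)

end HodgeTheory

/-! ### §3 The quaternion row: a Rosati-symmetric anticommuting pair `α² = a`, `β² = b`, and ANY generator `φ ∈ ℚ⟨α, β⟩` -/

section QuaternionRow

variable {A : AbelianVariety ℂ} {h : complexBetti A.X 2} {φ α β : A ⟶ A} {P : Polynomial ℤ} {e m : ℕ} {a b : ℂ}
  {u : complexBetti A.X 1 ≃ₗ[ℂ] complexBetti A.X 1}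

/-- **The `2 × 2` matrix block of a quaternion pair.** For `α^* α^* = a`, `β^* β^* = b` (`a, b ≠ 0`),
`α^* β^* = -β^* α^*`, `α^*` and `β^*` `Q_h`-symmetric: with `s = α^*/√a`, `t = β^*/√b` (`s² = t² = 1`, `st = -ts`) and
`p = ½(1 + s)`, the pair `x = (p, t p)`, `y = (p, p t)` is a matrix block on `H¹(A(ℂ); ℂ)` (`yᵢ xⱼ = δᵢⱼ p`,
`x₀ y₀ + x₁ y₁ = p + ½(1 - s) = 1`), `Q_h`-ORTHOGONAL (`p† = p`, `(tp)† = p t`), inside `B ⊗ ℂ` (`s, t ∈ S_λ ⊗ ℂ`),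
and its span contains `α^* = √a (x₀y₀ - x₁y₁)` and `β^* = √b (x₁y₀ + x₀y₁)`: the isomorphism `(a, b) ⊗ ℂ ≅ M₂(ℂ)`
matching the Rosati involution `x ↦ (αβ)⁻¹ x̄ (αβ)` with the transpose (the print's Table 1, type 2, `m = 1`: `B = D`; Table 2:
orthogonal involution on `Δ_ℂ^{(τ)}`). [cite: MoonenZarhin1998WeilClasses, §1 Tables 1–2 and «Δ ⊗ ℂ = ∏_τ Δ_ℂ^{(τ)}» (chunk p0002 L60–L118)]
[cite: vanGeemenVerra2003QuaternionicPryms, §4 (abelian varieties of quaternion type)] -/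
theorem exists_matrixUnits_of_quaternionPair (ha : a ≠ 0) (hα2 : pullbackOne A α * pullbackOne A α = a • 1)
    (hb : b ≠ 0) (hβ2 : pullbackOne A β * pullbackOne A β = b • 1)
    (hanti : pullbackOne A α * pullbackOne A β = -(pullbackOne A β * pullbackOne A α))
    (hαsym : ∀ v w : complexBetti A.X 1, polarizationPairingOne A.X h (A.dim - 1) (pullbackOne A α v) w =
      polarizationPairingOne A.X h (A.dim - 1) v (pullbackOne A α w))
    (hβsym : ∀ v w : complexBetti A.X 1, polarizationPairingOne A.X h (A.dim - 1) (pullbackOne A β v) w =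
      polarizationPairingOne A.X h (A.dim - 1) v (pullbackOne A β w)) :
    ∃ (x y : Fin 2 → Module.End ℂ (complexBetti A.X 1)) (p : Module.End ℂ (complexBetti A.X 1)),
      (∀ i j, y i * x j = if i = j then p else 0) ∧ (∑ i, x i * y i = 1) ∧
      (∀ i (v w : complexBetti A.X 1), polarizationPairingOne A.X h (A.dim - 1) (x i v) w =
        polarizationPairingOne A.X h (A.dim - 1) v (y i w)) ∧
      (∀ i, x i ∈ Algebra.adjoin ℂ (symmetricPullbackSpan A h : Set (Module.End ℂ (complexBetti A.X 1)))) ∧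
      (∀ i, y i ∈ Algebra.adjoin ℂ (symmetricPullbackSpan A h : Set (Module.End ℂ (complexBetti A.X 1)))) ∧
      ({pullbackOne A α, pullbackOne A β} : Set (Module.End ℂ (complexBetti A.X 1))) ⊆
        Submodule.span ℂ (Set.range fun ij : Fin 2 × Fin 2 ↦ x ij.1 * y ij.2) := by
  obtain ⟨σ, hσ⟩ := IsAlgClosed.exists_eq_mul_self a
  obtain ⟨ρ, hρ⟩ := IsAlgClosed.exists_eq_mul_self b
  have hσ0 : σ ≠ 0 := by
    rintro rfl
    exact ha (by rw [hσ, mul_zero])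
  have hρ0 : ρ ≠ 0 := by
    rintro rfl
    exact hb (by rw [hρ, mul_zero])
  set S := pullbackOne A α with hSdef
  set T := pullbackOne A β with hTdef
  set s : Module.End ℂ (complexBetti A.X 1) := σ⁻¹ • S with hsdef
  set t : Module.End ℂ (complexBetti A.X 1) := ρ⁻¹ • T with htdef
  have hs : s * s = 1 := by
    rw [hsdef, smul_mul_assoc, mul_smul_comm, smul_smul, hα2, smul_smul, hσ]
    rw [show σ⁻¹ * σ⁻¹ * (σ * σ) = 1 by field_simp, one_smul]
  have ht : t * t = 1 := by
    rw [htdef, smul_mul_assoc, mul_smul_comm, smul_smul, hβ2, smul_smul, hρ]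
    rw [show ρ⁻¹ * ρ⁻¹ * (ρ * ρ) = 1 by field_simp, one_smul]
  have hst : s * t = -(t * s) := by
    rw [hsdef, htdef, smul_mul_assoc, mul_smul_comm, smul_smul, hanti, smul_neg, smul_mul_assoc, mul_smul_comm,
      smul_smul, mul_comm ρ⁻¹ σ⁻¹]
  have hSs : S = σ • s := by rw [hsdef, smul_inv_smul₀ hσ0]
  have hTt : T = ρ • t := by rw [htdef, smul_inv_smul₀ hρ0]
  -- the symmetric generators lie in `S_λ ⊗ ℂ`
  have hs_symm : s ∈ symmetricPullbackSpan A h :=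
    Submodule.smul_mem _ _ ⟨Submodule.subset_span ⟨α, rfl⟩, hαsym⟩
  have ht_symm : t ∈ symmetricPullbackSpan A h :=
    Submodule.smul_mem _ _ ⟨Submodule.subset_span ⟨β, rfl⟩, hβsym⟩
  have hssym : ∀ v w : complexBetti A.X 1, polarizationPairingOne A.X h (A.dim - 1) (s v) w =
      polarizationPairingOne A.X h (A.dim - 1) v (s w) := hs_symm.2
  have htsym : ∀ v w : complexBetti A.X 1, polarizationPairingOne A.X h (A.dim - 1) (t v) w =
      polarizationPairingOne A.X h (A.dim - 1) v (t w) := ht_symm.2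
  -- the corner idempotent and the block
  set p : Module.End ℂ (complexBetti A.X 1) := (2:ℂ)⁻¹ • (1 + s) with hpdef
  have hpp : p * p = p := half_one_add_mul_self hs
  have hptp : p * t * p = 0 := half_one_add_mul_mul_half_one_add hs hst
  have htpt : t * p * t = (2:ℂ)⁻¹ • (1 - s) := mul_half_one_add_mul ht hst
  have hp_adj : p ∈ Algebra.adjoin ℂ (symmetricPullbackSpan A h : Set (Module.End ℂ (complexBetti A.X 1))) :=
    Subalgebra.smul_mem _ (Subalgebra.add_mem _ (Subalgebra.one_mem _) (Algebra.subset_adjoin hs_symm)) _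
  have ht_adj : t ∈ Algebra.adjoin ℂ (symmetricPullbackSpan A h : Set (Module.End ℂ (complexBetti A.X 1))) :=
    Algebra.subset_adjoin ht_symm
  have hpsym : ∀ v w : complexBetti A.X 1, polarizationPairingOne A.X h (A.dim - 1) (p v) w =
      polarizationPairingOne A.X h (A.dim - 1) v (p w) := by
    intro v w
    simp only [hpdef, LinearMap.smul_apply, LinearMap.add_apply, Module.End.one_apply, map_add, map_smul,
      LinearMap.add_apply, LinearMap.smul_apply, hssym]
  refine ⟨![p, t * p], ![p, p * t], p, ?_, ?_, ?_, ?_, ?_, ?_⟩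
  · -- `yᵢ xⱼ = δᵢⱼ p`
    have h01 : p * (t * p) = 0 := by rw [← mul_assoc, hptp]
    have h11 : p * t * (t * p) = p := by rw [mul_assoc, ← mul_assoc t, ht, one_mul, hpp]
    intro i j
    fin_cases i <;> fin_cases j <;> simp [hpp, h01, hptp, h11]
  · -- `Σ xᵢ yᵢ = 1`
    rw [Fin.sum_univ_two]
    simp only [Matrix.cons_val_zero, Matrix.cons_val_one]
    rw [hpp, mul_assoc, ← mul_assoc p p, hpp, ← mul_assoc, htpt, hpdef]
    exact half_one_add_add_half_one_sub
  · -- `Q_h`-orthogonality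
    intro i v w
    fin_cases i
    · exact hpsym v w
    · simp only [Fin.mk_one, Matrix.cons_val_one, Matrix.cons_val_zero, Module.End.mul_apply]
      rw [htsym, hpsym]
  · intro i
    fin_cases i
    · exact hp_adj
    · exact Subalgebra.mul_mem _ ht_adj hp_adj
  · intro i
    fin_cases i
    · exact hp_adj
    · exact Subalgebra.mul_mem _ hp_adj ht_adj
  · -- `α^*, β^*` lie in the block
    have hS : S = σ • (p * p) - σ • (t * p * (p * t)) := by
      rw [hpp, mul_assoc, ← mul_assoc p p, hpp, ← mul_assoc, htpt, ← smul_sub, hpdef,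
        half_one_add_sub_half_one_sub, hSs]
    have hT : T = ρ • (t * p * p) + ρ • (p * (p * t)) := by
      rw [mul_assoc t p p, hpp, ← mul_assoc p p t, hpp, ← smul_add, hpdef, eq_mul_half_one_add_add hst, hTt]
    refine Set.insert_subset_iff.2 ⟨?_, Set.singleton_subset_iff.2 ?_⟩
    · rw [hS]
      exact Submodule.sub_mem _ (Submodule.smul_mem _ _ (Submodule.subset_span ⟨(0, 0), rfl⟩))
        (Submodule.smul_mem _ _ (Submodule.subset_span ⟨(1, 1), rfl⟩))
    · rw [hT]
      exact Submodule.add_mem _ (Submodule.smul_mem _ _ (Submodule.subset_span ⟨(1, 0), rfl⟩))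
        (Submodule.smul_mem _ _ (Submodule.subset_span ⟨(0, 1), rfl⟩))

/-- **«`G_div(X) ⊆ Sl_F(V_X)`» FOR EVERY SUBFIELD OF THE QUATERNION ALGEBRA `ℚ⟨α, β⟩`** (every complex abelian variety `A`,
every `h` with `Q_h` non-degenerate): if `α^* α^* = a`, `β^* β^* = b` (`a, b ≠ 0`), `α^* β^* = -β^* α^*` with `α^*`,
`β^*` `Q_h`-symmetric, and `φ^* ∈ ℂ⟨α^*, β^*⟩`, then every `u ∈ G_div(X)(ℂ)` has `det(u | V_τ) = 1` for every `τ` —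
whether the generator `φ` is Rosati-symmetric, skew, or neither. [cite: MoonenZarhin1998WeilClasses, §1 proof of Criterion (2), type 2 (chunk p0003 L82–L90); Tables 1–2 (chunk p0002 L60–L118)]
[cite: McconnellRobson2001, 3.5.5–3.5.7] [cite: McDuffSalamon2017, Lemma 1.1.15] -/
theorem detOnEigenspace_eq_one_of_mem_divisorLefschetzGroup_of_quaternionPair
    (hnd : ∀ v : complexBetti A.X 1, (∀ w, polarizationPairingOne A.X h (A.dim - 1) v w = 0) → v = 0)
    (ha : a ≠ 0) (hα2 : pullbackOne A α * pullbackOne A α = a • 1)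
    (hb : b ≠ 0) (hβ2 : pullbackOne A β * pullbackOne A β = b • 1)
    (hanti : pullbackOne A α * pullbackOne A β = -(pullbackOne A β * pullbackOne A α))
    (hαsym : ∀ v w : complexBetti A.X 1, polarizationPairingOne A.X h (A.dim - 1) (pullbackOne A α v) w =
      polarizationPairingOne A.X h (A.dim - 1) v (pullbackOne A α w))
    (hβsym : ∀ v w : complexBetti A.X 1, polarizationPairingOne A.X h (A.dim - 1) (pullbackOne A β v) w =
      polarizationPairingOne A.X h (A.dim - 1) v (pullbackOne A β w))
    (hF : pullbackOne A φ ∈ Algebra.adjoin ℂ ({pullbackOne A α, pullbackOne A β} : Set (Module.End ℂ (complexBetti A.X 1))))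
    (hu : u ∈ divisorLefschetzGroup A h) (hc : ∀ v, u (pullbackOne A φ v) = pullbackOne A φ (u v)) (τ : ℂ) :
    detOnEigenspace u (pullbackOne A φ) hc τ = 1 := by
  obtain ⟨x, y, p, hxy, hsum, hadj, hx, hy, hST⟩ := exists_matrixUnits_of_quaternionPair ha hα2 hb hβ2 hanti hαsym hβsym
  exact detOnEigenspace_eq_one_of_mem_divisorLefschetzGroup_of_matrixUnits hxy hsum hadj hnd hx hy
    (adjoin_le_span_units_of_moritaData hxy hsum hST hF) hu hc τ

/-- **THE QUATERNION ROW — `W_F` IS DECOMPOSABLE FOR EVERY SUBFIELD `F = ℚ(φ)` OF THE QUATERNION ALGEBRA `ℚ⟨α, β⟩`.**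
Moonen–Zarhin's Criterion (2) for `Y` of type 2 («all classes in `W_F` are decomposable»), in the configuration
`α^* α^* = a`, `β^* β^* = b` (`a, b ≠ 0`), `α^* β^* = -β^* α^*`, `α^*`, `β^*` Rosati-symmetric (the positive involution
`x ↦ (αβ)⁻¹ x̄ (αβ)` of an indefinite quaternion algebra), for EVERY endomorphism `φ` with `φ^* ∈ ℂ⟨α^*, β^*⟩` and
`P(φ) = 0` (`P ∈ ℤ[T]` monic irreducible of degree `e`, `e · 2m = 2 dim A`), `h ∈ B¹(A) ⊗ ℂ` with `Q_h` non-degenerate: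
`W_F ⊗ ℂ ≤ 𝒟ᵐ ⊗ ℂ`. The generator may be symmetric (`φ = α`, the seat's g17-#3), skew (`φ = αβ`, g17-#5) or NEITHER
(e.g. `φ = α + αβ` with `φ² = a(1 - b)`): only the field `F ⊆ ℚ⟨α, β⟩` matters. PROVED on the carrier by the Morita
mechanism (§2) — no «connected and semi-simple». [cite: MoonenZarhin1998WeilClasses, §1 Criterion (2) and its proof, type 2 (chunk p0003 L46–L90); Table 1 (B = D for type 2, m = 1)]
[cite: Milne1999LefschetzClasses, Thm. 3.2, Cor. 4.5] [cite: vanGeemenVerra2003QuaternionicPryms, §4] -/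
theorem weilClassesField_le_divisorClassesSpan_of_quaternionPair
    (hPm : P.Monic) (hPe : P.natDegree = e) (hPirr : Irreducible (P.map (Int.castRingHom ℚ)))
    (hφ : Polynomial.eval₂ (Int.castRingHom (CategoryTheory.End A)) (φ : CategoryTheory.End A) P = 0)
    (her : e * (2 * m) = 2 * A.dim) (hh : h ∈ hodgeClassSpan A.dim A.X 1)
    (hnd : ∀ v : complexBetti A.X 1, (∀ w, polarizationPairingOne A.X h (A.dim - 1) v w = 0) → v = 0)
    (ha : a ≠ 0) (hα2 : pullbackOne A α * pullbackOne A α = a • 1)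
    (hb : b ≠ 0) (hβ2 : pullbackOne A β * pullbackOne A β = b • 1)
    (hanti : pullbackOne A α * pullbackOne A β = -(pullbackOne A β * pullbackOne A α))
    (hαsym : ∀ v w : complexBetti A.X 1, polarizationPairingOne A.X h (A.dim - 1) (pullbackOne A α v) w =
      polarizationPairingOne A.X h (A.dim - 1) v (pullbackOne A α w))
    (hβsym : ∀ v w : complexBetti A.X 1, polarizationPairingOne A.X h (A.dim - 1) (pullbackOne A β v) w =
      polarizationPairingOne A.X h (A.dim - 1) v (pullbackOne A β w))
    (hF : pullbackOne A φ ∈ Algebra.adjoin ℂ ({pullbackOne A α, pullbackOne A β} : Set (Module.End ℂ (complexBetti A.X 1)))) :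
    weilClassesField A φ P (2 * m) ≤ divisorClassesSpan A.X A.dim m := by
  obtain ⟨x, y, p, hxy, hsum, hadj, hx, hy, hST⟩ := exists_matrixUnits_of_quaternionPair ha hα2 hb hβ2 hanti hαsym hβsym
  exact weilClassesField_le_divisorClassesSpan_of_matrixUnits hPm hPe hPirr hφ her hh hnd hxy hsum hadj hx hy
    (adjoin_le_span_units_of_moritaData hxy hsum hST hF)

/-- **… consists of HODGE classes** (`W_F ⊗ ℂ ≤ ℬᵐ ⊗ ℂ`): Criterion (1)'s «all simple factors of type 1, 2 or 3 ⟹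
`n_σ = n_σ′`» on this locus, through decomposability. [cite: MoonenZarhin1998WeilClasses, §1 Criterion (2) (chunk p0003 L46–L58) and the Remark after the Criterion (chunk p0002 L1–L12)]
[cite: vanGeemen1994HodgeAV, §2.4] -/
theorem weilClassesField_le_hodgeClassSpan_of_quaternionPair
    (hPm : P.Monic) (hPe : P.natDegree = e) (hPirr : Irreducible (P.map (Int.castRingHom ℚ)))
    (hφ : Polynomial.eval₂ (Int.castRingHom (CategoryTheory.End A)) (φ : CategoryTheory.End A) P = 0)
    (her : e * (2 * m) = 2 * A.dim) (hh : h ∈ hodgeClassSpan A.dim A.X 1)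
    (hnd : ∀ v : complexBetti A.X 1, (∀ w, polarizationPairingOne A.X h (A.dim - 1) v w = 0) → v = 0)
    (ha : a ≠ 0) (hα2 : pullbackOne A α * pullbackOne A α = a • 1)
    (hb : b ≠ 0) (hβ2 : pullbackOne A β * pullbackOne A β = b • 1)
    (hanti : pullbackOne A α * pullbackOne A β = -(pullbackOne A β * pullbackOne A α))
    (hαsym : ∀ v w : complexBetti A.X 1, polarizationPairingOne A.X h (A.dim - 1) (pullbackOne A α v) w =
      polarizationPairingOne A.X h (A.dim - 1) v (pullbackOne A α w))
    (hβsym : ∀ v w : complexBetti A.X 1, polarizationPairingOne A.X h (A.dim - 1) (pullbackOne A β v) w =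
      polarizationPairingOne A.X h (A.dim - 1) v (pullbackOne A β w))
    (hF : pullbackOne A φ ∈ Algebra.adjoin ℂ ({pullbackOne A α, pullbackOne A β} : Set (Module.End ℂ (complexBetti A.X 1)))) :
    weilClassesField A φ P (2 * m) ≤ hodgeClassSpan A.dim A.X m :=
  (weilClassesField_le_divisorClassesSpan_of_quaternionPair hPm hPe hPirr hφ her hh hnd ha hα2 hb hβ2 hanti hαsym
      hβsym hF).trans
    (divisorClassesSpan_le_hodgeClassSpan_of_isSmoothProjective (AbelianVariety.isSmoothProjective_holds (A := A)) m)

/-- **… and is ALGEBRAIC**: `W_F ⊗ ℂ ≤ algebraicClasses A.X m` — THE WEIL CLASSES OF EVERY SUBFIELD OF THE QUATERNION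
ALGEBRA `ℚ⟨α, β⟩` (Rosati-symmetric anticommuting generators with non-zero squares) ARE ALGEBRAIC, by the Lefschetz
theorem on `(1,1)`-classes (the tree's `lefschetzOneOne_rational_holds`). [cite: MoonenZarhin1998WeilClasses, Introduction (chunk p0001 L10–L18) and §1 Criterion (2) (chunk p0003 L46–L90)]
[cite: VoisinHodgeI2002, Thm. 11.30] -/
theorem weilClassesField_le_algebraicClasses_of_quaternionPair
    (hPm : P.Monic) (hPe : P.natDegree = e) (hPirr : Irreducible (P.map (Int.castRingHom ℚ)))
    (hφ : Polynomial.eval₂ (Int.castRingHom (CategoryTheory.End A)) (φ : CategoryTheory.End A) P = 0)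
    (her : e * (2 * m) = 2 * A.dim) (hh : h ∈ hodgeClassSpan A.dim A.X 1)
    (hnd : ∀ v : complexBetti A.X 1, (∀ w, polarizationPairingOne A.X h (A.dim - 1) v w = 0) → v = 0)
    (ha : a ≠ 0) (hα2 : pullbackOne A α * pullbackOne A α = a • 1)
    (hb : b ≠ 0) (hβ2 : pullbackOne A β * pullbackOne A β = b • 1)
    (hanti : pullbackOne A α * pullbackOne A β = -(pullbackOne A β * pullbackOne A α))
    (hαsym : ∀ v w : complexBetti A.X 1, polarizationPairingOne A.X h (A.dim - 1) (pullbackOne A α v) w =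
      polarizationPairingOne A.X h (A.dim - 1) v (pullbackOne A α w))
    (hβsym : ∀ v w : complexBetti A.X 1, polarizationPairingOne A.X h (A.dim - 1) (pullbackOne A β v) w =
      polarizationPairingOne A.X h (A.dim - 1) v (pullbackOne A β w))
    (hF : pullbackOne A φ ∈ Algebra.adjoin ℂ ({pullbackOne A α, pullbackOne A β} : Set (Module.End ℂ (complexBetti A.X 1)))) :
    weilClassesField A φ P (2 * m) ≤ algebraicClasses A.X m :=
  (weilClassesField_le_divisorClassesSpan_of_quaternionPair hPm hPe hPirr hφ her hh hnd ha hα2 hb hβ2 hanti hαsym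
      hβsym hF).trans
    (AbelianVariety.divisorClassesSpan_le_algebraicClasses A
      (fun c hc hc' ↦ lefschetzOneOne_rational_holds (AbelianVariety.isSmoothProjective_holds (A := A)) c hc hc') m)

/-- Element form: every class of `W_F ⊗ ℂ` — in particular every rational Weil class relative to a subfield of the
quaternion algebra `ℚ⟨α, β⟩` — is a `ℂ`-combination of algebraic classes. [cite: MoonenZarhin1998WeilClasses, Introduction (chunk p0001 L10–L18) and §1 Criterion (2) (chunk p0003 L46–L90)] -/
theorem mem_algebraicClasses_of_mem_weilClassesField_of_quaternionPair
    (hPm : P.Monic) (hPe : P.natDegree = e) (hPirr : Irreducible (P.map (Int.castRingHom ℚ)))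
    (hφ : Polynomial.eval₂ (Int.castRingHom (CategoryTheory.End A)) (φ : CategoryTheory.End A) P = 0)
    (her : e * (2 * m) = 2 * A.dim) (hh : h ∈ hodgeClassSpan A.dim A.X 1)
    (hnd : ∀ v : complexBetti A.X 1, (∀ w, polarizationPairingOne A.X h (A.dim - 1) v w = 0) → v = 0)
    (ha : a ≠ 0) (hα2 : pullbackOne A α * pullbackOne A α = a • 1)
    (hb : b ≠ 0) (hβ2 : pullbackOne A β * pullbackOne A β = b • 1)
    (hanti : pullbackOne A α * pullbackOne A β = -(pullbackOne A β * pullbackOne A α))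
    (hαsym : ∀ v w : complexBetti A.X 1, polarizationPairingOne A.X h (A.dim - 1) (pullbackOne A α v) w =
      polarizationPairingOne A.X h (A.dim - 1) v (pullbackOne A α w))
    (hβsym : ∀ v w : complexBetti A.X 1, polarizationPairingOne A.X h (A.dim - 1) (pullbackOne A β v) w =
      polarizationPairingOne A.X h (A.dim - 1) v (pullbackOne A β w))
    (hF : pullbackOne A φ ∈ Algebra.adjoin ℂ ({pullbackOne A α, pullbackOne A β} : Set (Module.End ℂ (complexBetti A.X 1))))
    {c : complexBetti A.X (2 * m)} (hc : c ∈ weilClassesField A φ P (2 * m)) : c ∈ algebraicClasses A.X m :=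
  weilClassesField_le_algebraicClasses_of_quaternionPair hPm hPe hPirr hφ her hh hnd ha hα2 hb hβ2 hanti hαsym hβsym hF hc

/-- **The `2 × 2` block of a quaternion pair lies in `ℂ⟨α^*, β^*⟩`.** Same block as
`exists_matrixUnits_of_quaternionPair` (`x = (p, t p)`, `y = (p, p t)`, `p = ½(1 + α^*/√a)`, `t = β^*/√b`), recording
in addition that every `xᵢ`, `yᵢ` is a (non-commutative) polynomial in `α^*`, `β^*` — so the block commutes with every
operator commuting with `α^*` and `β^*` (the centre `E₀ ⊗ ℂ` of `D ⊗ ℂ`, and the matrix units of a power `X = Y^m`: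
the print's `B = M_m(D)`, Table 1, type 2). [cite: MoonenZarhin1998WeilClasses, §1 Tables 1–2 and «Δ ⊗ ℂ = ∏_τ Δ_ℂ^{(τ)}» (chunk p0002 L60–L118)]
[cite: McconnellRobson2001, 3.5.5–3.5.7] -/
theorem exists_matrixUnits_of_quaternionPair_mem_adjoin (ha : a ≠ 0) (hα2 : pullbackOne A α * pullbackOne A α = a • 1)
    (hb : b ≠ 0) (hβ2 : pullbackOne A β * pullbackOne A β = b • 1)
    (hanti : pullbackOne A α * pullbackOne A β = -(pullbackOne A β * pullbackOne A α))
    (hαsym : ∀ v w : complexBetti A.X 1, polarizationPairingOne A.X h (A.dim - 1) (pullbackOne A α v) w =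
      polarizationPairingOne A.X h (A.dim - 1) v (pullbackOne A α w))
    (hβsym : ∀ v w : complexBetti A.X 1, polarizationPairingOne A.X h (A.dim - 1) (pullbackOne A β v) w =
      polarizationPairingOne A.X h (A.dim - 1) v (pullbackOne A β w)) :
    ∃ (x y : Fin 2 → Module.End ℂ (complexBetti A.X 1)) (p : Module.End ℂ (complexBetti A.X 1)),
      (∀ i j, y i * x j = if i = j then p else 0) ∧ (∑ i, x i * y i = 1) ∧
      (∀ i (v w : complexBetti A.X 1), polarizationPairingOne A.X h (A.dim - 1) (x i v) w =
        polarizationPairingOne A.X h (A.dim - 1) v (y i w)) ∧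
      (∀ i, x i ∈ Algebra.adjoin ℂ (symmetricPullbackSpan A h : Set (Module.End ℂ (complexBetti A.X 1)))) ∧
      (∀ i, y i ∈ Algebra.adjoin ℂ (symmetricPullbackSpan A h : Set (Module.End ℂ (complexBetti A.X 1)))) ∧
      ({pullbackOne A α, pullbackOne A β} : Set (Module.End ℂ (complexBetti A.X 1))) ⊆
        Submodule.span ℂ (Set.range fun ij : Fin 2 × Fin 2 ↦ x ij.1 * y ij.2) ∧
      (∀ i, x i ∈ Algebra.adjoin ℂ ({pullbackOne A α, pullbackOne A β} : Set (Module.End ℂ (complexBetti A.X 1)))) ∧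
      (∀ i, y i ∈ Algebra.adjoin ℂ ({pullbackOne A α, pullbackOne A β} : Set (Module.End ℂ (complexBetti A.X 1)))) := by
  obtain ⟨σ, hσ⟩ := IsAlgClosed.exists_eq_mul_self a
  obtain ⟨ρ, hρ⟩ := IsAlgClosed.exists_eq_mul_self b
  have hσ0 : σ ≠ 0 := by
    rintro rfl
    exact ha (by rw [hσ, mul_zero])
  have hρ0 : ρ ≠ 0 := by
    rintro rfl
    exact hb (by rw [hρ, mul_zero])
  set S := pullbackOne A α with hSdef
  set T := pullbackOne A β with hTdef
  set s : Module.End ℂ (complexBetti A.X 1) := σ⁻¹ • S with hsdef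
  set t : Module.End ℂ (complexBetti A.X 1) := ρ⁻¹ • T with htdef
  have hs : s * s = 1 := by
    rw [hsdef, smul_mul_assoc, mul_smul_comm, smul_smul, hα2, smul_smul, hσ]
    rw [show σ⁻¹ * σ⁻¹ * (σ * σ) = 1 by field_simp, one_smul]
  have ht : t * t = 1 := by
    rw [htdef, smul_mul_assoc, mul_smul_comm, smul_smul, hβ2, smul_smul, hρ]
    rw [show ρ⁻¹ * ρ⁻¹ * (ρ * ρ) = 1 by field_simp, one_smul]
  have hst : s * t = -(t * s) := by
    rw [hsdef, htdef, smul_mul_assoc, mul_smul_comm, smul_smul, hanti, smul_neg, smul_mul_assoc, mul_smul_comm,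
      smul_smul, mul_comm ρ⁻¹ σ⁻¹]
  have hSs : S = σ • s := by rw [hsdef, smul_inv_smul₀ hσ0]
  have hTt : T = ρ • t := by rw [htdef, smul_inv_smul₀ hρ0]
  -- the symmetric generators lie in `S_λ ⊗ ℂ`
  have hs_symm : s ∈ symmetricPullbackSpan A h :=
    Submodule.smul_mem _ _ ⟨Submodule.subset_span ⟨α, rfl⟩, hαsym⟩
  have ht_symm : t ∈ symmetricPullbackSpan A h :=
    Submodule.smul_mem _ _ ⟨Submodule.subset_span ⟨β, rfl⟩, hβsym⟩
  have hssym : ∀ v w : complexBetti A.X 1, polarizationPairingOne A.X h (A.dim - 1) (s v) w =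
      polarizationPairingOne A.X h (A.dim - 1) v (s w) := hs_symm.2
  have htsym : ∀ v w : complexBetti A.X 1, polarizationPairingOne A.X h (A.dim - 1) (t v) w =
      polarizationPairingOne A.X h (A.dim - 1) v (t w) := ht_symm.2
  -- the corner idempotent and the block
  set p : Module.End ℂ (complexBetti A.X 1) := (2:ℂ)⁻¹ • (1 + s) with hpdef
  have hpp : p * p = p := half_one_add_mul_self hs
  have hptp : p * t * p = 0 := half_one_add_mul_mul_half_one_add hs hst
  have htpt : t * p * t = (2:ℂ)⁻¹ • (1 - s) := mul_half_one_add_mul ht hst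
  have hp_adj : p ∈ Algebra.adjoin ℂ (symmetricPullbackSpan A h : Set (Module.End ℂ (complexBetti A.X 1))) :=
    Subalgebra.smul_mem _ (Subalgebra.add_mem _ (Subalgebra.one_mem _) (Algebra.subset_adjoin hs_symm)) _
  have ht_adj : t ∈ Algebra.adjoin ℂ (symmetricPullbackSpan A h : Set (Module.End ℂ (complexBetti A.X 1))) :=
    Algebra.subset_adjoin ht_symm
  -- … and in `ℂ⟨α^*, β^*⟩`
  have hs_gen : s ∈ Algebra.adjoin ℂ ({S, T} : Set (Module.End ℂ (complexBetti A.X 1))) :=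
    Subalgebra.smul_mem _ (Algebra.subset_adjoin (Set.mem_insert _ _)) _
  have ht_gen : t ∈ Algebra.adjoin ℂ ({S, T} : Set (Module.End ℂ (complexBetti A.X 1))) :=
    Subalgebra.smul_mem _ (Algebra.subset_adjoin (Set.mem_insert_of_mem _ (Set.mem_singleton _))) _
  have hp_gen : p ∈ Algebra.adjoin ℂ ({S, T} : Set (Module.End ℂ (complexBetti A.X 1))) :=
    Subalgebra.smul_mem _ (Subalgebra.add_mem _ (Subalgebra.one_mem _) hs_gen) _
  have hpsym : ∀ v w : complexBetti A.X 1, polarizationPairingOne A.X h (A.dim - 1) (p v) w =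
      polarizationPairingOne A.X h (A.dim - 1) v (p w) := by
    intro v w
    simp only [hpdef, LinearMap.smul_apply, LinearMap.add_apply, Module.End.one_apply, map_add, map_smul,
      LinearMap.add_apply, LinearMap.smul_apply, hssym]
  refine ⟨![p, t * p], ![p, p * t], p, ?_, ?_, ?_, ?_, ?_, ?_, ?_, ?_⟩
  · -- `yᵢ xⱼ = δᵢⱼ p`
    have h01 : p * (t * p) = 0 := by rw [← mul_assoc, hptp]
    have h11 : p * t * (t * p) = p := by rw [mul_assoc, ← mul_assoc t, ht, one_mul, hpp]
    intro i j
    fin_cases i <;> fin_cases j <;> simp [hpp, h01, hptp, h11]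
  · -- `Σ xᵢ yᵢ = 1`
    rw [Fin.sum_univ_two]
    simp only [Matrix.cons_val_zero, Matrix.cons_val_one]
    rw [hpp, mul_assoc, ← mul_assoc p p, hpp, ← mul_assoc, htpt, hpdef]
    exact half_one_add_add_half_one_sub
  · -- `Q_h`-orthogonality
    intro i v w
    fin_cases i
    · exact hpsym v w
    · simp only [Fin.mk_one, Matrix.cons_val_one, Matrix.cons_val_zero, Module.End.mul_apply]
      rw [htsym, hpsym]
  · intro i
    fin_cases i
    · exact hp_adj
    · exact Subalgebra.mul_mem _ ht_adj hp_adj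
  · intro i
    fin_cases i
    · exact hp_adj
    · exact Subalgebra.mul_mem _ hp_adj ht_adj
  · -- `α^*, β^*` lie in the block
    have hS : S = σ • (p * p) - σ • (t * p * (p * t)) := by
      rw [hpp, mul_assoc, ← mul_assoc p p, hpp, ← mul_assoc, htpt, ← smul_sub, hpdef,
        half_one_add_sub_half_one_sub, hSs]
    have hT : T = ρ • (t * p * p) + ρ • (p * (p * t)) := by
      rw [mul_assoc t p p, hpp, ← mul_assoc p p t, hpp, ← smul_add, hpdef, eq_mul_half_one_add_add hst, hTt]
    refine Set.insert_subset_iff.2 ⟨?_, Set.singleton_subset_iff.2 ?_⟩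
    · rw [hS]
      exact Submodule.sub_mem _ (Submodule.smul_mem _ _ (Submodule.subset_span ⟨(0, 0), rfl⟩))
        (Submodule.smul_mem _ _ (Submodule.subset_span ⟨(1, 1), rfl⟩))
    · rw [hT]
      exact Submodule.add_mem _ (Submodule.smul_mem _ _ (Submodule.subset_span ⟨(1, 0), rfl⟩))
        (Submodule.smul_mem _ _ (Submodule.subset_span ⟨(0, 1), rfl⟩))
  · intro i
    fin_cases i
    · exact hp_gen
    · exact Subalgebra.mul_mem _ ht_gen hp_gen
  · intro i
    fin_cases i
    · exact hp_gen
    · exact Subalgebra.mul_mem _ hp_gen ht_gen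

/-- **The `2 × 2` block of an ABSTRACT Rosati-symmetric anticommuting pair.** The construction of
`exists_matrixUnits_of_quaternionPair_mem_adjoin` for any two operators `S, T ∈ B ⊗ ℂ = ℂ⟨S_λ ⊗ ℂ⟩` (not necessarily
pull-backs of endomorphisms) with `S² = a`, `T² = b` (`a, b ≠ 0`), `S T = -T S`, both `Q_h`-symmetric: with
`s = S/√a`, `t = T/√b`, `p = ½(1 + s)`, the pair `x = (p, t p)`, `y = (p, p t)` is a `Q_h`-orthogonal matrix block inside
`B ⊗ ℂ` and inside `ℂ⟨S, T⟩`, whose span contains `S` and `T`.  Intended for the NORMALISED generators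
`α^* · a(ψ^*)^{-1/2}`, `β^* · b(ψ^*)^{-1/2}` (squares `1`) of a quaternion algebra `E₀⟨α, β⟩`, `α² = a(ψ)`, `β² = b(ψ)`
in a real-multiplication centre `E₀ = ℚ(ψ)` — the print's type 2 with `e₀ ≥ 1`, «`Δ_ℂ^{(τ)} ≅ M_{2m}(ℂ)`» place by
place. [cite: MoonenZarhin1998WeilClasses, §1 Tables 1–2 and «Δ ⊗ ℂ = ∏_τ Δ_ℂ^{(τ)}» (chunk p0002 L60–L118)]
[cite: McconnellRobson2001, 3.5.5–3.5.7] -/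
theorem exists_matrixUnits_of_symmetric_anticommuting_pair {S T : Module.End ℂ (complexBetti A.X 1)}
    (ha : a ≠ 0) (hS2 : S * S = a • 1) (hb : b ≠ 0) (hT2 : T * T = b • 1) (hanti : S * T = -(T * S))
    (hSsym : ∀ v w : complexBetti A.X 1, polarizationPairingOne A.X h (A.dim - 1) (S v) w =
      polarizationPairingOne A.X h (A.dim - 1) v (S w))
    (hTsym : ∀ v w : complexBetti A.X 1, polarizationPairingOne A.X h (A.dim - 1) (T v) w =
      polarizationPairingOne A.X h (A.dim - 1) v (T w))
    (hSmem : S ∈ Algebra.adjoin ℂ (symmetricPullbackSpan A h : Set (Module.End ℂ (complexBetti A.X 1))))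
    (hTmem : T ∈ Algebra.adjoin ℂ (symmetricPullbackSpan A h : Set (Module.End ℂ (complexBetti A.X 1)))) :
    ∃ (x y : Fin 2 → Module.End ℂ (complexBetti A.X 1)) (p : Module.End ℂ (complexBetti A.X 1)),
      (∀ i j, y i * x j = if i = j then p else 0) ∧ (∑ i, x i * y i = 1) ∧
      (∀ i (v w : complexBetti A.X 1), polarizationPairingOne A.X h (A.dim - 1) (x i v) w =
        polarizationPairingOne A.X h (A.dim - 1) v (y i w)) ∧
      (∀ i, x i ∈ Algebra.adjoin ℂ (symmetricPullbackSpan A h : Set (Module.End ℂ (complexBetti A.X 1)))) ∧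
      (∀ i, y i ∈ Algebra.adjoin ℂ (symmetricPullbackSpan A h : Set (Module.End ℂ (complexBetti A.X 1)))) ∧
      ({S, T} : Set (Module.End ℂ (complexBetti A.X 1))) ⊆
        Submodule.span ℂ (Set.range fun ij : Fin 2 × Fin 2 ↦ x ij.1 * y ij.2) ∧
      (∀ i, x i ∈ Algebra.adjoin ℂ ({S, T} : Set (Module.End ℂ (complexBetti A.X 1)))) ∧
      (∀ i, y i ∈ Algebra.adjoin ℂ ({S, T} : Set (Module.End ℂ (complexBetti A.X 1)))) := by
  obtain ⟨σ, hσ⟩ := IsAlgClosed.exists_eq_mul_self a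
  obtain ⟨ρ, hρ⟩ := IsAlgClosed.exists_eq_mul_self b
  have hσ0 : σ ≠ 0 := by
    rintro rfl
    exact ha (by rw [hσ, mul_zero])
  have hρ0 : ρ ≠ 0 := by
    rintro rfl
    exact hb (by rw [hρ, mul_zero])
  set s : Module.End ℂ (complexBetti A.X 1) := σ⁻¹ • S with hsdef
  set t : Module.End ℂ (complexBetti A.X 1) := ρ⁻¹ • T with htdef
  have hs : s * s = 1 := by
    rw [hsdef, smul_mul_assoc, mul_smul_comm, smul_smul, hS2, smul_smul, hσ]
    rw [show σ⁻¹ * σ⁻¹ * (σ * σ) = 1 by field_simp, one_smul]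
  have ht : t * t = 1 := by
    rw [htdef, smul_mul_assoc, mul_smul_comm, smul_smul, hT2, smul_smul, hρ]
    rw [show ρ⁻¹ * ρ⁻¹ * (ρ * ρ) = 1 by field_simp, one_smul]
  have hst : s * t = -(t * s) := by
    rw [hsdef, htdef, smul_mul_assoc, mul_smul_comm, smul_smul, hanti, smul_neg, smul_mul_assoc, mul_smul_comm,
      smul_smul, mul_comm ρ⁻¹ σ⁻¹]
  have hSs : S = σ • s := by rw [hsdef, smul_inv_smul₀ hσ0]
  have hTt : T = ρ • t := by rw [htdef, smul_inv_smul₀ hρ0]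
  have hssym : ∀ v w : complexBetti A.X 1, polarizationPairingOne A.X h (A.dim - 1) (s v) w =
      polarizationPairingOne A.X h (A.dim - 1) v (s w) := by
    intro v w
    rw [hsdef, LinearMap.smul_apply, LinearMap.smul_apply, map_smul, LinearMap.smul_apply, map_smul, hSsym]
  have htsym : ∀ v w : complexBetti A.X 1, polarizationPairingOne A.X h (A.dim - 1) (t v) w =
      polarizationPairingOne A.X h (A.dim - 1) v (t w) := by
    intro v w
    rw [htdef, LinearMap.smul_apply, LinearMap.smul_apply, map_smul, LinearMap.smul_apply, map_smul, hTsym]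
  -- the corner idempotent and the block
  set p : Module.End ℂ (complexBetti A.X 1) := (2:ℂ)⁻¹ • (1 + s) with hpdef
  have hpp : p * p = p := half_one_add_mul_self hs
  have hptp : p * t * p = 0 := half_one_add_mul_mul_half_one_add hs hst
  have htpt : t * p * t = (2:ℂ)⁻¹ • (1 - s) := mul_half_one_add_mul ht hst
  have hs_adj : s ∈ Algebra.adjoin ℂ (symmetricPullbackSpan A h : Set (Module.End ℂ (complexBetti A.X 1))) :=
    Subalgebra.smul_mem _ hSmem _
  have ht_adj : t ∈ Algebra.adjoin ℂ (symmetricPullbackSpan A h : Set (Module.End ℂ (complexBetti A.X 1))) :=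
    Subalgebra.smul_mem _ hTmem _
  have hp_adj : p ∈ Algebra.adjoin ℂ (symmetricPullbackSpan A h : Set (Module.End ℂ (complexBetti A.X 1))) :=
    Subalgebra.smul_mem _ (Subalgebra.add_mem _ (Subalgebra.one_mem _) hs_adj) _
  -- … and in `ℂ⟨S, T⟩`
  have hs_gen : s ∈ Algebra.adjoin ℂ ({S, T} : Set (Module.End ℂ (complexBetti A.X 1))) :=
    Subalgebra.smul_mem _ (Algebra.subset_adjoin (Set.mem_insert _ _)) _
  have ht_gen : t ∈ Algebra.adjoin ℂ ({S, T} : Set (Module.End ℂ (complexBetti A.X 1))) :=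
    Subalgebra.smul_mem _ (Algebra.subset_adjoin (Set.mem_insert_of_mem _ (Set.mem_singleton _))) _
  have hp_gen : p ∈ Algebra.adjoin ℂ ({S, T} : Set (Module.End ℂ (complexBetti A.X 1))) :=
    Subalgebra.smul_mem _ (Subalgebra.add_mem _ (Subalgebra.one_mem _) hs_gen) _
  have hpsym : ∀ v w : complexBetti A.X 1, polarizationPairingOne A.X h (A.dim - 1) (p v) w =
      polarizationPairingOne A.X h (A.dim - 1) v (p w) := by
    intro v w
    simp only [hpdef, LinearMap.smul_apply, LinearMap.add_apply, Module.End.one_apply, map_add, map_smul,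
      LinearMap.add_apply, LinearMap.smul_apply, hssym]
  refine ⟨![p, t * p], ![p, p * t], p, ?_, ?_, ?_, ?_, ?_, ?_, ?_, ?_⟩
  · -- `yᵢ xⱼ = δᵢⱼ p`
    have h01 : p * (t * p) = 0 := by rw [← mul_assoc, hptp]
    have h11 : p * t * (t * p) = p := by rw [mul_assoc, ← mul_assoc t, ht, one_mul, hpp]
    intro i j
    fin_cases i <;> fin_cases j <;> simp [hpp, h01, hptp, h11]
  · -- `Σ xᵢ yᵢ = 1`
    rw [Fin.sum_univ_two]
    simp only [Matrix.cons_val_zero, Matrix.cons_val_one]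
    rw [hpp, mul_assoc, ← mul_assoc p p, hpp, ← mul_assoc, htpt, hpdef]
    exact half_one_add_add_half_one_sub
  · -- `Q_h`-orthogonality
    intro i v w
    fin_cases i
    · exact hpsym v w
    · simp only [Fin.mk_one, Matrix.cons_val_one, Matrix.cons_val_zero, Module.End.mul_apply]
      rw [htsym, hpsym]
  · intro i
    fin_cases i
    · exact hp_adj
    · exact Subalgebra.mul_mem _ ht_adj hp_adj
  · intro i
    fin_cases i
    · exact hp_adj
    · exact Subalgebra.mul_mem _ hp_adj ht_adj
  · -- `S, T` lie in the block
    have hS : S = σ • (p * p) - σ • (t * p * (p * t)) := by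
      rw [hpp, mul_assoc, ← mul_assoc p p, hpp, ← mul_assoc, htpt, ← smul_sub, hpdef,
        half_one_add_sub_half_one_sub, hSs]
    have hT : T = ρ • (t * p * p) + ρ • (p * (p * t)) := by
      rw [mul_assoc t p p, hpp, ← mul_assoc p p t, hpp, ← smul_add, hpdef, eq_mul_half_one_add_add hst, hTt]
    refine Set.insert_subset_iff.2 ⟨?_, Set.singleton_subset_iff.2 ?_⟩
    · rw [hS]
      exact Submodule.sub_mem _ (Submodule.smul_mem _ _ (Submodule.subset_span ⟨(0, 0), rfl⟩))
        (Submodule.smul_mem _ _ (Submodule.subset_span ⟨(1, 1), rfl⟩))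
    · rw [hT]
      exact Submodule.add_mem _ (Submodule.smul_mem _ _ (Submodule.subset_span ⟨(1, 0), rfl⟩))
        (Submodule.smul_mem _ _ (Submodule.subset_span ⟨(0, 1), rfl⟩))
  · intro i
    fin_cases i
    · exact hp_gen
    · exact Subalgebra.mul_mem _ ht_gen hp_gen
  · intro i
    fin_cases i
    · exact hp_gen
    · exact Subalgebra.mul_mem _ hp_gen ht_gen

end QuaternionRow

end Literature.AlgebraicGeometry.HodgeTheory

end
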